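import Summits.AnomalousDissipation.AnomalousDissipation.Theses.QuarticLadder
import Summits.AnomalousDissipation.AnomalousDissipation.Theorems.UniformResolution.Negative.FGTBound
import Summits.AnomalousDissipation.AnomalousDissipation.Theorems.UniformResolution.Negative.ShearLaw
import Summits.AnomalousDissipation.AnomalousDissipation.Theorems.UniformResolution.Negative.Shape
import Summits.AnomalousDissipation.AnomalousDissipation.Theorems.MomentLadder.Negative.LoadBearing

/-!
# Disproof of `UniformResolution` — findings of the standing adversary (cdisprove, stmt-AnomalousDissipation-14330)

Crux: `Summit.AnomalousDissipation.AnomalousDissipation.Theses.QuarticLadder.UniformResolution` (route QuarticLadder,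
binder 3 of `closes`) ≡ `…Theses.MomentParity.UniformResolution` (route MomentParity, rank 4) — ONE proposition, two route
rows (`quarticLadder_uniformResolution_iff`, `Iff.rfl`). Restated (`uniformResolution_iff` of `Negative/Shape.lean`) as

  `∀ f` admissible, `∀ ν_j > 0 → 0`, `∀ E`, `∀ ε > 0`:
    `(∀ j, IsLoudFamilyAt f ν_j E ε) → ∃ E' ε' > 0, ∀ j, IsResolvedLoudFamilyAt f ν_j E' ε'`.

THIS FILE (rev 11, generation-2 seat refuter-cdisprove-stmt-AnomalousDissipation-14330-g2-0, 2026-08-17) IMPORTS the landed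
negative files `Theorems/UniformResolution/Negative/{Shape, ShearLaw, ResolutionCriterion, Agmon, SteadyStates, SteadyResolved,
FGTBound}.lean` (generation 1, p83586–p88682) instead of carrying copies (revs 1–7), and contains, SORRY-FREE: §BRIDGE (FGT bridge,
gen 1, not landed — the lead c15 proves S3 through `CylRow.exists_cylindricalTest` instead), §D–§G (load-bearing table etc., gen 1,
LANDED as `Negative/LoadBearing.lean`, p154940 ACCEPTED), the NEW generation-2 ROW BARRIER §RB (LANDED `Negative/RowBarrierAtoms.lean` p154949 and
`Negative/RowBarrierLeakLaw.lean` p155317, `Negative/RowBarrier.lean` p155917 — all three ACCEPTED) and §MX MIXING (strategist b1's mixing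
lemma with a law-independent index + "admixture cannot repair the leak family"; LANDED as `Negative/Mixture.lean`, p157789 ACCEPTED).
All five generation-2 proposals are in the tree; the local copies below shadow the landed names (namespace priority) and stay as
the readable record for ideators/planners.

EXTENSIONS CHECKED ON PAPER (not formalised; available on request, same atom technique): (i) the barrier survives ANY FGT exponent
`p ≥ 1` in the weight `(1+G)⁻ᵖ` (the landed row has `p = 4`; `p ≥ 2` is what the Agmon absorption needs): `e_n = n²(1+2π²n²)⁻ᵖ < w_A`
for large `n` iff `p ≥ 1`, masses rebalanced by shrinking the cutoff constant; (ii) it also survives adding ALL ENERGY-FUNCTION rows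
`Ψ(K_N(u))` of every degree (K-balanced design: each consumer paired with a producer of the SAME energy — cutoff atom `S_{n,1/2}` with
`S_{1,1/2}`, shell-2 consumer `S_{2,d}` with `S_{1,d}`, `d ≤ 1/16` so that `w(2π²d²) < 4w(8π²d²)` makes the pair FGT-negative; forcing-shell
`±a` pairs are automatically FGT-neutral); what NO atom design can add is the family of ENSTROPHY-function rows `Φ(G)` (at enstrophy above
the laminar value every shear atom has `Ġ < 0`) — consistent with the plain enstrophy row being the resolving one.

## Verdict (gen 2, cycle 1): NO KILL; the live line's two rows are certified blind to the open core

* Everything of the gen-1 verdict stands (below). New: a deterministic refutation of the PER-FAMILY UPGRADE of the rows the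
  line `Sketch` has in hand. S4 `stub_loudUI` asks for UNIFORM INTEGRABILITY of the enstrophy over a loud invariant level family
  at fixed `ν`; S1–S3 + the energy row deliver exactly: the energy row (→ `N`-uniform MEAN enstrophy bound) and the FGT row
  (→ weighted `H²` bound `WeightedH2Bound 4`, → tightness in probability). §RB (`rowBarrier`, `not_rowsForceUniformIntegrability`,
  `not_rowsForceResolution`): for EVERY `ν > 0` an admissible force (`4π²ν cos(2πx₁)e₀`) and explicit four-atom laws on SHEAR
  states at every level `n ≥ 2` — `p_A δ_{[S_{1,1/2}]} + p_C δ_{[S_{1,−1/4}]} + (8n²)⁻¹ δ_{[S_{n,1}]} + p_0 δ_0` with `p_A, p_C`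
  solving the 2 × 2 system — satisfy BOTH ROWS EXACTLY (`leakLaw_energyRow`, `isFGTStationary_leakLaw`), are probability laws
  carried by level-`n` fields in the unit ball, LOUD `n`-uniformly (energy `≤ 1`, dissipation `≥ π²ν/4`), mean enstrophy `≤ π²`,
  carry the weighted `H²` bound (landed `weightedH2Bound_four_of_fgt`) — and are NOT uniformly integrable (a fixed quantum `π²/4`
  of mean enstrophy sits on the cutoff shell with mass `(8n²)⁻¹`) and NOT resolved by any `κ`. The plain enstrophy row, which
  WOULD resolve them (it bounds `E‖Δū‖²`), is violated at rate `π⁴ν(n²−1)` (`leakLaw_enstrophyRow`): it is exactly the row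
  whose stretching term `E∫⟪(ū·∇)ū, Δū⟫` has no `N`-uniform closure, and the FGT weight that absorbs the stretching pointwise is
  blind to WHERE the enstrophy sits. So any proof of S4 (⟺ crux) must use rows on which `B(u,u)` is visible and not absorbed.
* Complement (checked on paper, recorded so nobody re-derives it): with NON-interacting atoms the LINEAR rows plus the energy
  row already force laminarity (`E‖∇u‖² ≥ ‖∇E u‖² = ‖∇U_lam‖²` = input/ν, Jensen) — hence gen-1's `not_uniformResolutionMeanRowOnly`
  had to use zero force, and §RB keeps the energy row and drops the linear ones; an S4-SHAPED (j-uniform, `ν_j → 0`) version of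
  the barrier is not available by atoms: in the rows-only world loud UI families exist too (consumption on a fixed shell
  `K_j ≍ ν_j^{-1/2}`), so the barrier is intrinsically per-family — which is the currency of the twin crux `ResolvedDissipation`.
* No `-- Targets`: the line's stubs are S3 (provable, true: `stub_weightedH2` = `weightedH2Bound_four_of_fgt ∘` the bridge of §BRIDGE
  or `CylRow.exists_cylindricalTest`) and S4 (crux-equivalent by the landed necessity p89716; not refutable short of the summit —
  gen-1 §A/§F/§H, strategist censuses s1/b1). Nothing in payload `stuck_stubs`.

## Verdict (gen 1, cycle 1 — retained): NO KILL — and exactly where a kill would have to live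

* `¬ UniformResolution` (`not_uniformResolution_iff`) = ∃ an admissible force with a d-wise GALERKIN-ENSEMBLE ZEROTH LAW
  (`DwiseGalerkinInvariantLoud`) AND, for every budget pair, a viscosity with no resolved loud family: any refutation first proves a
  zeroth law for converged Galerkin ensembles of an explicit force — out of reach; no clause is reachable by junk (spectral
  `eGradNormSq`, Bochner pairings with all derivatives on smooth tests, Borel laws on `H`; `∀ j, 0 < ν j` is REDUNDANT).
* The zero force and every sub-floor force are quiet (force floor `ε ≤ ‖f‖₂√E`): there the crux is VACUOUSLY true (§B, landed `Shape`).
* At FIXED viscosity resolved loud families exist (laminar Kolmogorov Diracs, §E): the content is the `j`-UNIFORM budget pair.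
* THE STEADY SECTOR IS RESOLVED (§F; `Negative/SteadyResolved.lean`): `¬ UniformResolution` lives only in the world "ensemble zeroth law
  TRUE for f, Galerkin STEADY zeroth law FALSE for f, and EVERY loud invariant family of f leaks enstrophy to the cutoff N-frequently at
  some fixed ν_j".
* RESOLUTION CRITERION + FGT BOUND (§H; `Negative/ResolutionCriterion.lean`, `Negative/FGTBound.lean`, §BRIDGE): UniformResolution ⇐
  MomentClosure ∧ UNIFORM INTEGRABILITY OF THE ENSTROPHY over the loud invariant family at each ν_j — the UI is THE open part (only the
  MEAN enstrophy is known N-uniformly, FMRT IV (1.31)–(1.33)); a refutation must force INTERMITTENT enstrophy on every loud invariant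
  family of some force at some fixed viscosity — the ensemble shadow of a statistically recurrent energy-dropping Leray–Hopf solution.
* Barriers catalogue (`Literature/Barriers/AnomalousDissipation/*`): none bites; negatives index: nothing on this crux.

## Map of the file (all sorry-free; `lean check` rc 0)

§0 `quarticLadder_uniformResolution_iff`. §BRIDGE `fgtPsi/fgtRho/fgtProfile`, `wframeField`, `IsGalerkinStationaryCyl`, `fgtTest`,
`isFGTStationary_of_isGalerkinStationaryCyl`, `isFGTStationary_of_isStationaryStatisticalSolution`. §D LOAD-BEARING TABLE
(`not_uniformResolutionMeanRowOnly`, `not_uniformResolutionWithoutStationarity`, `not_uniformResolutionWithoutEpsPos`,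
`uniformResolutionWithoutNuPos_iff`). §E FIXED VISCOSITY (`isResolvedLoudFamilyAt_laminar`, `laminar_instance_constant_viscosity`).
§H CRITERION APPLIED (`isResolvedLoudFamilyAt_of_criterion`, `isResolvedLoudFamilyAt_of_fgt_of_uniformlyIntegrable`). §F STEADY SECTOR
(`isResolvedLoudFamilyAt_of_steady`, `not_isLoudSteadyFamilyAt_of_not_uniformResolution`). §G `refutation_scenario_iff_not_uniformResolution`.
§RB ROW BARRIER: atoms (`coef/trunc/lapTrunc/gradSq/lapSq/fgtWeight_shearState`, `energyRow_shearState`, `enstrophyRow_shearState`,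
`fgtRow_shearState`), atomic laws (`atomic`, `integral_atomic`, `lintegral_atomic`, `ae_atomic`), weights (`wA wC wB leakE`, masses,
`leak_rows_system`), the leak law (`leakLaw`, `leakForce`, `leakLaw_energyRow`, `leakLaw_fgtRow`, `isFGTStationary_leakLaw`,
`leakLaw_enstrophyRow`, budgets), the leak (`not_uniformlyIntegrableEnstrophy_leakLaw`, `not_isResolved_leakLaw`), the barrier
(`rowBarrier`, `RowsForceUniformIntegrability`, `RowsForceResolution` and their negations; `tight_not_uniformlyIntegrable_leakLaw`).
§MX MIXING: `lintegral_band_le`, `resolved_left_at_of_isResolved_mixture`, `exists_mixIdx`, `exists_isResolved_left_of_mixture`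
(freedom F1 void, law-independent reparametrisation), `not_isResolved_mixture_leakLaw` (admixing finite-enstrophy laws with a fixed
weight never resolves the leak family).

## For the provers (positive side)

At FIXED ν = ν_j the conclusion asks for a family (μ_N)_N with tight enstrophy spectrum uniformly in N. Parts proved: MomentClosure
(S1, p89032); poly→cyl (S2, p87397); spectral tail; weighted H² bound for FGT-stationary laws (`fgt_integral_bound`, exponent 4,
N-uniform, radius-free); UI + weighted H² ⇒ resolved (criterion); resolved ⇒ UI (necessity p89716). OPEN = UI of the enstrophy =
S4, and §RB certifies that it is NOT a consequence of the rows currently extracted: the next row to bring in is one where the cubic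
term is load-bearing (plain enstrophy row / `Ψ = G²`, i.e. the superlinear closure), or pathwise information (LHEE bracket, b1 census).
-/

-- `Summit.<Summit>.<Problem>` duplicate namespace is the tree's mandated layout for single-conjunct summits.
set_option linter.dupNamespace false

namespace Summit.AnomalousDissipation.AnomalousDissipation.Cruxes.UniformResolution.Disproof

open MeasureTheory Filter Topology
open scoped ENNReal InnerProductSpace RealInnerProductSpace
open Literature.Analysis.FunctionSpaces Literature.Analysis.FluidPDE
open Summit.AnomalousDissipation.AnomalousDissipation.Theses.MomentParity
open Summit.AnomalousDissipation.AnomalousDissipation.Theorems.QuarticGate.Negative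
open Summit.AnomalousDissipation.AnomalousDissipation.Theorems
open Summit.AnomalousDissipation.AnomalousDissipation.Theorems.UniformResolution.Negative
open Summit.AnomalousDissipation.AnomalousDissipation.Theorems.ResolvedDissipation.Negative
  (shearFreq shearSet shearField shearState shearField_mul shearField_zero neg_mem_shearSet freqNormSq_of_mem_shearSet
    ne_zero_of_mem_shearSet card_shearSet isSmooth_shearField isDivFree_shearField hasZeroMean_shearField
    convect_shearField_self coe_shearState_ae isLevel_shearState norm_sq_shearState eGradNormSq_shearState
    eGradNormSq_fourierTruncate_shearState mFourierCoeff_shearField_eq_zero integral_norm_sq_shearField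
    isTransversal_kolCoeff_shearSet fourierTruncate_shearField eGradNormSq_zero fourierTruncate_congr_ae)

noncomputable section

/-- Local notation for the real Hilbert space `L²(T³; ℝ³)`. -/
local notation "L2T3" => Lp (EuclideanSpace ℝ (Fin 3)) 2 (volume : Measure (UnitAddTorus (Fin 3)))

/-! ## 0. One proposition, two route rows -/

/-- `QuarticLadder.UniformResolution` and `MomentParity.UniformResolution` have definitionally equal bodies. [folklore] -/
theorem quarticLadder_uniformResolution_iff :
    Summit.AnomalousDissipation.AnomalousDissipation.Theses.QuarticLadder.UniformResolution ↔ UniformResolution :=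
  Iff.rfl

/-! ## BRIDGE. Galerkin-stationary laws (cylindrical sense) with bounded support are FGT-stationary -/

section FGTBridge

open Literature.Analysis.FluidPDE.Torus (CylindricalTest galerkinCutoff frameField frameFieldIdx FrameIdx freqBall₀
  frameVec IsStationaryStatisticalSolution)

/-! ### The scalar profile `ψ(s) = −(1+s)⁻³/6` and the radial FGT profile -/

/-- The FGT scalar profile `ψ(s) = −(1+s)⁻³/6`; `ψ'(s) = ½(1+s)⁻⁴`. -/
def fgtPsi (t : ℝ) : ℝ := -(((1 + t) ^ 3)⁻¹ / 6)

/-- `hasDerivAt_fgtPsi` (bookkeeping). [folklore] -/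
theorem hasDerivAt_fgtPsi {t : ℝ} (ht : 0 ≤ t) : HasDerivAt fgtPsi (2⁻¹ * ((1 + t) ^ 4)⁻¹) t := by
  have hne : (1 + t) ^ 3 ≠ 0 := by positivity
  have h1t : (1 + t) ≠ 0 := by positivity
  have h0 : HasDerivAt (fun s : ℝ => (1 + s) ^ 3) (3 * (1 + t) ^ 2) t := by
    simpa using ((hasDerivAt_id t).const_add 1).fun_pow 3
  have h : HasDerivAt fgtPsi (-(-(3 * (1 + t) ^ 2) / ((1 + t) ^ 3) ^ 2 / 6)) t := ((h0.inv hne).div_const 6).neg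
  refine h.congr_deriv ?_
  field_simp
  ring

/-- The radial profile `ρ(s) = ψ(s) χ(s/a)`. -/
def fgtRho (a s : ℝ) : ℝ := fgtPsi s * galerkinCutoff (s / a)

/-- `hasDerivAt_fgtRho` (bookkeeping). [folklore] -/
theorem hasDerivAt_fgtRho {a s : ℝ} (ha : 0 < a) (hs0 : 0 ≤ s) (hs : s < a) :
    HasDerivAt (fgtRho a) (2⁻¹ * ((1 + s) ^ 4)⁻¹) s := by
  have hball : s / a ∈ Metric.ball (0 : ℝ) galerkinCutoff.rIn := by
    rw [Metric.mem_ball, Real.dist_eq, sub_zero, abs_of_nonneg (by positivity)]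
    show s / a < 1
    rwa [div_lt_one ha]
  have hcut : (fun t : ℝ => (galerkinCutoff : ℝ → ℝ) (t / a)) =ᶠ[𝓝 s] fun _ => 1 :=
    ((continuous_id.div_const a).continuousAt).eventually (galerkinCutoff.eventuallyEq_one_of_mem_ball hball)
  have heq : fgtRho a =ᶠ[𝓝 s] fgtPsi := by
    filter_upwards [hcut] with t ht
    rw [fgtRho, ht, mul_one]
  exact (hasDerivAt_fgtPsi hs0).congr_of_eventuallyEq heq

/-- The FGT profile `φ(ξ) = ρ(‖ξ‖²)` on `ℝⁿ`. -/
def fgtProfile (n : ℕ) (a : ℝ) : EuclideanSpace ℝ (Fin n) → ℝ := fun ξ => fgtRho a (‖ξ‖ ^ 2)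

/-- `contDiff_fgtProfile` (bookkeeping). [folklore] -/
theorem contDiff_fgtProfile (n : ℕ) (a : ℝ) : ContDiff ℝ 1 (fgtProfile n a) := by
  have h1 : ContDiff ℝ 1 (fun ξ : EuclideanSpace ℝ (Fin n) => -((((1 : ℝ) + ‖ξ‖ ^ 2) ^ 3)⁻¹ / 6)) :=
    ((((contDiff_const.add (contDiff_norm_sq ℝ)).pow 3).inv fun ξ => by positivity).div_const 6).neg
  have h2 : ContDiff ℝ 1 (fun ξ : EuclideanSpace ℝ (Fin n) => (galerkinCutoff : ℝ → ℝ) (‖ξ‖ ^ 2 / a)) :=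
    (galerkinCutoff.contDiff (n := 1)).comp ((contDiff_norm_sq ℝ).div_const a)
  exact h1.mul h2

/-- `hasCompactSupport_fgtProfile` (bookkeeping). [folklore] -/
theorem hasCompactSupport_fgtProfile (n : ℕ) {a : ℝ} (ha : 0 < a) : HasCompactSupport (fgtProfile n a) := by
  refine HasCompactSupport.intro (isCompact_closedBall (0 : EuclideanSpace ℝ (Fin n)) (Real.sqrt (2 * a)))
    fun ξ hξ => ?_
  rw [Metric.mem_closedBall, dist_zero_right, not_le] at hξ
  have h2 : 2 * a < ‖ξ‖ ^ 2 := (Real.sqrt_lt' ((Real.sqrt_nonneg _).trans_lt hξ)).1 hξ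
  have h3 : galerkinCutoff.rOut ≤ dist (‖ξ‖ ^ 2 / a) 0 := by
    rw [Real.dist_eq, sub_zero, abs_of_nonneg (by positivity)]
    show (2 : ℝ) ≤ ‖ξ‖ ^ 2 / a
    rw [le_div_iff₀ ha]
    linarith
  change fgtRho a (‖ξ‖ ^ 2) = 0
  rw [fgtRho, galerkinCutoff.zero_of_le_dist h3, mul_zero]

/-- **The derivative of the FGT profile inside the cutoff**: `∂ᵢφ(ξ) = (1+‖ξ‖²)⁻⁴ ξᵢ` for `‖ξ‖² < a`. [folklore] -/
theorem fderiv_fgtProfile_single {n : ℕ} {a : ℝ} (ha : 0 < a) {ξ : EuclideanSpace ℝ (Fin n)} (hξ : ‖ξ‖ ^ 2 < a)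
    (i : Fin n) :
    _root_.fderiv ℝ (fgtProfile n a) ξ (EuclideanSpace.single i 1) = ((1 + ‖ξ‖ ^ 2) ^ 4)⁻¹ * ξ i := by
  have h := (hasDerivAt_fgtRho ha (sq_nonneg _) hξ).comp_hasFDerivAt ξ (hasStrictFDerivAt_norm_sq ξ).hasFDerivAt
  rw [show fgtProfile n a = fgtRho a ∘ fun x : EuclideanSpace ℝ (Fin n) => ‖x‖ ^ 2 from rfl, h.fderiv]
  simp [innerSL_apply_apply, EuclideanSpace.inner_single_right]
  ring

/-! ### The enstrophy-weighted frame -/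

/-- The weight `√(4π²|k|²)`. -/
def wgt (k : Fin 3 → ℤ) : ℝ := Real.sqrt (4 * Real.pi ^ 2 * Torus.freqNormSq k)

/-- `wgt_sq` (bookkeeping). [folklore] -/
theorem wgt_sq (k : Fin 3 → ℤ) : wgt k ^ 2 = 4 * Real.pi ^ 2 * Torus.freqNormSq k :=
  Real.sq_sqrt (mul_nonneg (by positivity) (Torus.freqNormSq_nonneg k))

/-- `wgt_mul_wgt` (bookkeeping). [folklore] -/
theorem wgt_mul_wgt (k : Fin 3 → ℤ) : wgt k * wgt k = 4 * Real.pi ^ 2 * Torus.freqNormSq k := by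
  rw [← sq, wgt_sq]

/-- The enstrophy-weighted frame field `√(4π²|k|²) · (frame field)`, as a real trigonometric polynomial. -/
def wframeField (k : Fin 3 → ℤ) (j : Fin 3) (c : Bool) : UnitAddTorus (Fin 3) → EuclideanSpace ℝ (Fin 3) :=
  Torus.realTrigPoly {k} fun _ => ((wgt k : ℝ) : ℂ) • frameVec k j c

/-- `wframeField_apply` (bookkeeping). [folklore] -/
theorem wframeField_apply (k : Fin 3 → ℤ) (j : Fin 3) (c : Bool) (x : UnitAddTorus (Fin 3)) :
    wframeField k j c x = wgt k • frameField k j c x := by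
  rw [wframeField, frameField, Torus.realTrigPoly_singleton_apply, Torus.realTrigPoly_singleton_apply,
    Torus.smul_realPart_mFourier_smul]

/-- `isDivFree_wframeField` (bookkeeping). [folklore] -/
theorem isDivFree_wframeField {k : Fin 3 → ℤ} (hk : k ≠ 0) (j : Fin 3) (c : Bool) :
    Torus.IsDivFree (wframeField k j c) := by
  refine Torus.isDivFree_realTrigPoly_singleton ?_
  have h := Torus.sum_mul_frameVec hk j c
  simp only [PiLp.smul_apply, smul_eq_mul]
  calc ∑ i, (k i : ℂ) * (((wgt k : ℝ) : ℂ) * frameVec k j c i) = ((wgt k : ℝ) : ℂ) * ∑ i, (k i : ℂ) * frameVec k j c i := by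
        rw [Finset.mul_sum]; exact Finset.sum_congr rfl fun i _ => by ring
    _ = 0 := by rw [h, mul_zero]

/-- `integral_wframeField` (bookkeeping). [folklore] -/
theorem integral_wframeField {k : Fin 3 → ℤ} (hk : k ≠ 0) (j : Fin 3) (c : Bool) : ∫ x, wframeField k j c x = 0 := by
  simp_rw [wframeField, Torus.realTrigPoly_singleton_apply]
  have hi : Integrable (fun x : UnitAddTorus (Fin 3) => UnitAddTorus.mFourier k x • (((wgt k : ℝ) : ℂ) • frameVec k j c)) volume :=
    ((UnitAddTorus.mFourier k).continuous.smul continuous_const).integrable_unitAddTorus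
  rw [ContinuousLinearMap.integral_comp_comm _ hi, integral_smul_const, Torus.integral_mFourier, if_neg hk, zero_smul,
    map_zero]

/-- Pairings with the weighted frame field scale by the weight. [folklore] -/
theorem integral_inner_wframeField (w : UnitAddTorus (Fin 3) → EuclideanSpace ℝ (Fin 3)) (k : Fin 3 → ℤ) (j : Fin 3) (c : Bool) :
    ∫ y, ⟪w y, wframeField k j c y⟫_ℝ = wgt k * ∫ y, ⟪w y, frameField k j c y⟫_ℝ := by
  rw [← integral_const_mul]
  refine integral_congr_ae (ae_of_all _ fun y => ?_)
  show ⟪w y, wframeField k j c y⟫_ℝ = wgt k * ⟪w y, frameField k j c y⟫_ℝ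
  rw [wframeField_apply, inner_smul_right]

/-- The weighted frame field attached to an index. -/
def wframeFieldIdx (N : ℕ) (p : FrameIdx (Fin 3) N) : UnitAddTorus (Fin 3) → EuclideanSpace ℝ (Fin 3) :=
  wframeField (p.1 : Fin 3 → ℤ) p.2.1 p.2.2

/-- The weighted frame fields of level `N` are admissible level-`N` band tests. [folklore] -/
theorem isBandTest_wframeField {N : ℕ} {k : Fin 3 → ℤ} (hk : k ∈ freqBall₀ N) (j : Fin 3) (c : Bool) :
    IsBandTest N (wframeField k j c) :=
  ⟨Torus.isSmooth_realTrigPoly _ _, isDivFree_wframeField (Torus.ne_zero_of_mem_freqBall₀ ⟨k, hk⟩) j c,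
    integral_wframeField (Torus.ne_zero_of_mem_freqBall₀ ⟨k, hk⟩) j c,
    fun _ hk' => CubicParityLoud.Negative.mFourierCoeff_realTrigPoly_singleton_eq_zero_of_not_mem hk _ hk'⟩

/-- A law is **Galerkin-stationary at level `N` in the cylindrical sense**: it annihilates the generator row of
every cylindrical test functional (FMRT's class `𝒯`) whose fields are level-`N` band tests — the FMRT form of
Galerkin invariance at level `N` (for band-limited tests the Navier–Stokes and the Galerkin generators coincide),
the natural output of MomentClosure. -/
def IsGalerkinStationaryCyl (ν : ℝ) (f : UnitAddTorus (Fin 3) → EuclideanSpace ℝ (Fin 3)) (N : ℕ)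
    (μ : Measure (Torus.energySpace (Fin 3))) : Prop :=
  ∀ Φ : CylindricalTest (Fin 3), (∀ i, IsBandTest N (Φ.g i)) →
    Integrable (fun u => Torus.nsGeneratorPairing ν f u (Φ.grad u)) μ ∧
      ∫ u, Torus.nsGeneratorPairing ν f u (Φ.grad u) ∂μ = 0

/-- FMRT-stationary statistical solutions of the full system are in particular Galerkin-stationary at every level
in the cylindrical sense. [folklore] -/
theorem isGalerkinStationaryCyl_of_isStationaryStatisticalSolution {ν : ℝ}
    {f : UnitAddTorus (Fin 3) → EuclideanSpace ℝ (Fin 3)} {μ : Measure (Torus.energySpace (Fin 3))}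
    (hS : IsStationaryStatisticalSolution ν f μ) (N : ℕ) : IsGalerkinStationaryCyl ν f N μ :=
  fun Φ _ => hS.generator Φ

/-! ### The FGT cylindrical test functional -/

/-- **The FGT cylindrical test functional** of level `N` and cutoff scale `a > 0`: enstrophy-weighted frame
coordinates `(u, √(4π²|k|²) g_{kjc})` and the profile `ψ(‖ξ‖²)χ(‖ξ‖²/a)`, so that `‖ξ(u)‖² = G(u)` and, on
`{G < a}`, `Φ'(u) = (1+G(u))⁻⁴ · (−ΔP_N u)`. -/
def fgtTest (N : ℕ) {a : ℝ} (ha : 0 < a) : CylindricalTest (Fin 3) where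
  m := Fintype.card (FrameIdx (Fin 3) N)
  g i := wframeFieldIdx N ((Fintype.equivFin (FrameIdx (Fin 3) N)).symm i)
  g_smooth _ := Torus.isSmooth_realTrigPoly _ _
  g_divFree _ := isDivFree_wframeField (Torus.ne_zero_of_mem_freqBall₀ _) _ _
  g_zeroMean _ := integral_wframeField (Torus.ne_zero_of_mem_freqBall₀ _) _ _
  φ := fgtProfile _ a
  φ_contDiff := contDiff_fgtProfile _ a
  φ_compact := hasCompactSupport_fgtProfile _ ha

/-- The fields of `fgtTest` are level-`N` band tests. [folklore] -/
theorem isBandTest_fgtTest_g (N : ℕ) {a : ℝ} (ha : 0 < a) (i : Fin (fgtTest N ha).m) : IsBandTest N ((fgtTest N ha).g i) :=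
  isBandTest_wframeField (Finset.coe_mem _) _ _

/-- Sums over the coordinates of `fgtTest` are sums over the frame. [folklore] -/
theorem sum_fgtTest_eq {M : Type*} [AddCommMonoid M] (N : ℕ) {a : ℝ} (ha : 0 < a)
    (F : (Fin 3 → ℤ) → Fin 3 → Bool → M) :
    ∑ i : Fin (fgtTest N ha).m,
        F (((Fintype.equivFin (FrameIdx (Fin 3) N)).symm i).1 : Fin 3 → ℤ)
          ((Fintype.equivFin (FrameIdx (Fin 3) N)).symm i).2.1 ((Fintype.equivFin (FrameIdx (Fin 3) N)).symm i).2.2 =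
      ∑ k ∈ freqBall₀ N, ∑ j : Fin 3, ∑ c : Bool, F k j c := by
  have h1 : ∑ i : Fin (fgtTest N ha).m,
      F (((Fintype.equivFin (FrameIdx (Fin 3) N)).symm i).1 : Fin 3 → ℤ)
        ((Fintype.equivFin (FrameIdx (Fin 3) N)).symm i).2.1 ((Fintype.equivFin (FrameIdx (Fin 3) N)).symm i).2.2 =
      ∑ p : FrameIdx (Fin 3) N, F (p.1 : Fin 3 → ℤ) p.2.1 p.2.2 :=
    Fintype.sum_equiv (Fintype.equivFin (FrameIdx (Fin 3) N)).symm _ _ fun _ => rfl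
  rw [h1, Fintype.sum_prod_type, ← Finset.sum_coe_sort (freqBall₀ N)]
  refine Finset.sum_congr rfl fun k _ => ?_
  rw [Fintype.sum_prod_type]

/-- The coordinates of `fgtTest` are the weighted pairings. [folklore] -/
theorem fgtTest_coords_apply (N : ℕ) {a : ℝ} (ha : 0 < a) (u : Torus.energySpace (Fin 3)) (i : Fin (fgtTest N ha).m) :
    (fgtTest N ha).coords u i =
      Torus.pairing (u : L2T3) (wframeField ((((Fintype.equivFin (FrameIdx (Fin 3) N)).symm i).1 : Fin 3 → ℤ))
        ((Fintype.equivFin (FrameIdx (Fin 3) N)).symm i).2.1 ((Fintype.equivFin (FrameIdx (Fin 3) N)).symm i).2.2) :=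
  rfl

/-- **`‖ξ(u)‖² = G(u)`**: the weighted frame computes the enstrophy of the truncation. [folklore] -/
theorem norm_sq_fgtTest_coords (N : ℕ) {a : ℝ} (ha : 0 < a) (u : Torus.energySpace (Fin 3)) :
    ‖(fgtTest N ha).coords u‖ ^ 2 = gradSq N u := by
  have hint := integrable_coe u
  have hdiv := Torus.isWeaklyDivFree_of_mem_energySpace u.2
  rw [EuclideanSpace.real_norm_sq_eq]
  simp_rw [fgtTest_coords_apply]
  rw [sum_fgtTest_eq N ha (fun k j c => Torus.pairing (u : L2T3) (wframeField k j c) ^ 2)]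
  have key : ∀ k ∈ freqBall₀ N, ∑ j : Fin 3, ∑ c : Bool, Torus.pairing (u : L2T3) (wframeField k j c) ^ 2 =
      4 * Real.pi ^ 2 * Torus.freqNormSq k * ‖coef u k‖ ^ 2 := by
    intro k _
    simp_rw [Torus.pairing, integral_inner_wframeField, mul_pow, ← Finset.mul_sum, frameField,
      Torus.integral_inner_realTrigPoly_singleton hint]
    rw [Torus.sum_sum_sq_re_inner_frameVec (hdiv.sum_mul_mFourierCoeff_eq_zero (Lp.memLp _) k), wgt_sq]
    rfl
  rw [Finset.sum_congr rfl key, gradSq, Finset.mul_sum, freqBall₀, Finset.sum_erase _ (by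
    rw [Torus.freqNormSq_zero]; ring)]
  exact Finset.sum_congr rfl fun k _ => by ring

/-- **`Σᵢ ξᵢ(u) gᵢ = −ΔP_N u`**: the weighted frame synthesises the Laplacian of the truncation. [folklore] -/
theorem sum_coords_smul_g_fgtTest (N : ℕ) {a : ℝ} (ha : 0 < a) (u : Torus.energySpace (Fin 3)) (x : UnitAddTorus (Fin 3)) :
    ∑ i, (fgtTest N ha).coords u i • (fgtTest N ha).g i x = lapTrunc N u x := by
  have hint := integrable_coe u
  have hdiv := Torus.isWeaklyDivFree_of_mem_energySpace u.2
  have h1 : ∑ i, (fgtTest N ha).coords u i • (fgtTest N ha).g i x =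
      ∑ k ∈ freqBall₀ N, ∑ j : Fin 3, ∑ c : Bool, Torus.pairing (u : L2T3) (wframeField k j c) • wframeField k j c x := by
    simp_rw [fgtTest_coords_apply]
    exact sum_fgtTest_eq N ha (fun k j c => Torus.pairing (u : L2T3) (wframeField k j c) • wframeField k j c x)
  rw [h1]
  have key : ∀ k ∈ freqBall₀ N, ∑ j : Fin 3, ∑ c : Bool, Torus.pairing (u : L2T3) (wframeField k j c) • wframeField k j c x =
      EuclideanSpace.realPart (UnitAddTorus.mFourier k x • lapCoef u k) := by
    intro k _
    simp_rw [Torus.pairing, integral_inner_wframeField, wframeField_apply, smul_smul, mul_comm _ (wgt k),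
      ← mul_assoc, wgt_mul_wgt, mul_smul (4 * Real.pi ^ 2 * Torus.freqNormSq k), ← Finset.smul_sum]
    simp_rw [frameField, Torus.integral_inner_realTrigPoly_singleton hint, Torus.realTrigPoly_singleton_apply,
      Torus.smul_realPart_mFourier_smul, ← map_sum, ← Finset.smul_sum]
    rw [Torus.sum_sum_re_inner_frameVec_smul (hdiv.sum_mul_mFourierCoeff_eq_zero (Lp.memLp _) k)]
    rw [Torus.smul_realPart_mFourier_smul]
    rfl
  rw [Finset.sum_congr rfl key, freqBall₀, Finset.sum_erase _ (by rw [lapCoef_zero, smul_zero, map_zero]), lapTrunc,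
    Torus.realTrigPoly_apply_eq_sum]

/-- `G(u) ≤ 4π²N²‖u‖²`. [folklore] -/
theorem gradSq_le (N : ℕ) (u : Torus.energySpace (Fin 3)) : gradSq N u ≤ 4 * Real.pi ^ 2 * (N : ℝ) ^ 2 * ‖u‖ ^ 2 := by
  unfold gradSq
  have hint := integrable_coe u
  have h1 : ∑ k ∈ Torus.freqBall N, Torus.freqNormSq k * ‖coef u k‖ ^ 2 ≤ (N : ℝ) ^ 2 * ∑ k ∈ Torus.freqBall N, ‖coef u k‖ ^ 2 := by
    rw [Finset.mul_sum]
    exact Finset.sum_le_sum fun k hk => mul_le_mul_of_nonneg_right (Torus.mem_freqBall.1 hk) (sq_nonneg _)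
  have h2 : ∑ k ∈ Torus.freqBall N, ‖coef u k‖ ^ 2 ≤ ‖u‖ ^ 2 := by
    have e := Torus.integral_norm_sq_fourierTruncate hint N
    have le := Torus.integral_norm_sq_fourierTruncate_le (Lp.memLp (u.1 : L2T3)) N
    rw [e] at le
    have : ‖u‖ = ‖(u.1 : L2T3)‖ := rfl
    rw [this, ← Torus.integral_norm_sq_coe_eq]
    exact le
  have hpi : 0 < Real.pi := Real.pi_pos
  nlinarith [mul_le_mul_of_nonneg_left (h1.trans (mul_le_mul_of_nonneg_left h2 (by positivity)))
    (by positivity : (0 : ℝ) ≤ 4 * Real.pi ^ 2)]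

/-- **The differential of the FGT functional is `(1+G(u))⁻⁴ · (−ΔP_N u)`** for `G(u) < a`. [folklore] -/
theorem grad_fgtTest (N : ℕ) {a : ℝ} (ha : 0 < a) (u : Torus.energySpace (Fin 3)) (hu : gradSq N u < a) :
    (fgtTest N ha).grad u = fun x => fgtWeight N u • lapTrunc N u x := by
  have hξ : ‖(fgtTest N ha).coords u‖ ^ 2 < a := by rw [norm_sq_fgtTest_coords]; exact hu
  funext x
  change ∑ i, (_root_.fderiv ℝ (fgtProfile _ a) ((fgtTest N ha).coords u) (EuclideanSpace.single i 1)) •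
    (fgtTest N ha).g i x = _
  simp_rw [fderiv_fgtProfile_single ha hξ, norm_sq_fgtTest_coords, mul_smul, ← Finset.smul_sum,
    sum_coords_smul_g_fgtTest]
  rfl

/-- **BRIDGE: Galerkin-stationary laws (cylindrical sense) carried by level-`N` fields in a ball are FGT-stationary.**
The generator identity for the cylindrical functional `fgtTest N a`, `a = 4π²N²R² + 1` (whose fields are level-`N`
band tests), is the weighted row `∫ (1+G)⁻⁴⟨F(u), −ΔP_N u⟩ dμ = 0`. Galerkin-INVARIANT laws at level `N` with bounded
support qualify (MomentClosure). [folklore] -/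
theorem isFGTStationary_of_isGalerkinStationaryCyl {ν : ℝ} {f : UnitAddTorus (Fin 3) → EuclideanSpace ℝ (Fin 3)}
    (hf : Torus.IsSmooth f) {N : ℕ} {μ : Measure (Torus.energySpace (Fin 3))} [IsProbabilityMeasure μ]
    (hS : IsGalerkinStationaryCyl ν f N μ) {R : ℝ} (hlev : ∀ᵐ u ∂μ, IsLevel N u) (hR : ∀ᵐ u ∂μ, ‖u‖ ≤ R) :
    IsFGTStationary ν f N μ := by
  set a : ℝ := 4 * Real.pi ^ 2 * (N : ℝ) ^ 2 * R ^ 2 + 1 with ha_def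
  have ha : 0 < a := by positivity
  obtain ⟨hint, hzero⟩ := hS (fgtTest N ha) (isBandTest_fgtTest_g N ha)
  -- on the support the differential is the weighted Laplacian, and the row factorises
  have hrow : ∀ᵐ u ∂μ, Torus.nsGeneratorPairing ν f u ((fgtTest N ha).grad u) =
      fgtWeight N u * Torus.nsGeneratorPairing ν f u (lapTrunc N u) := by
    filter_upwards [hR] with u hu
    have hG : gradSq N u < a := by
      have h1 := gradSq_le N u
      have h2 : ‖u‖ ^ 2 ≤ R ^ 2 := by
        have := norm_nonneg u
        nlinarith
      have hpi : 0 < Real.pi := Real.pi_pos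
      have h3 : 4 * Real.pi ^ 2 * (N : ℝ) ^ 2 * ‖u‖ ^ 2 ≤ 4 * Real.pi ^ 2 * (N : ℝ) ^ 2 * R ^ 2 :=
        mul_le_mul_of_nonneg_left h2 (by positivity)
      rw [ha_def]; linarith
    rw [grad_fgtTest N ha u hG]
    have e : (fun x => fgtWeight N u • lapTrunc N u x) =
        fun x => ∑ i : Fin 1, (fun _ : Fin 1 => fgtWeight N u) i • (fun _ : Fin 1 => lapTrunc N u) i x := by
      funext x; simp
    rw [e, Torus.nsGeneratorPairing_sum_smul ν hf.continuous.integrable_unitAddTorus u Finset.univ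
      (fun _ : Fin 1 => fgtWeight N u) (g := fun _ : Fin 1 => lapTrunc N u) fun _ _ => Torus.isSmooth_realTrigPoly _ _]
    simp
  refine ⟨inferInstance, ⟨R, hR⟩, hlev, hint.congr hrow, ?_⟩
  rw [← integral_congr_ae hrow]
  exact hzero

/-- In particular FMRT-stationary statistical solutions of the full system carried by level-`N` fields in a ball
are FGT-stationary (e.g. Dirac masses at laminar states). [folklore] -/
theorem isFGTStationary_of_isStationaryStatisticalSolution {ν : ℝ} {f : UnitAddTorus (Fin 3) → EuclideanSpace ℝ (Fin 3)}
    (hf : Torus.IsSmooth f) {μ : Measure (Torus.energySpace (Fin 3))} (hS : IsStationaryStatisticalSolution ν f μ)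
    {N : ℕ} {R : ℝ} (hlev : ∀ᵐ u ∂μ, IsLevel N u) (hR : ∀ᵐ u ∂μ, ‖u‖ ≤ R) : IsFGTStationary ν f N μ := by
  haveI := hS.prob
  exact isFGTStationary_of_isGalerkinStationaryCyl hf (isGalerkinStationaryCyl_of_isStationaryStatisticalSolution hS N)
    hlev hR

end FGTBridge

/-! ## D. Load-bearing analysis: which hypotheses of `UniformResolution` matter -/

section LoadBearing

/-- WEAKENING 1 of the antecedent (statement STRENGTHENED): `UniformResolution` with the antecedent's
stationarity required for LINEAR observables only (`d = 2`: the mean-flow row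
`νAū + P_N ∫B(u,u)dμ = P_N f`) instead of every order `d`. -/
def UniformResolutionMeanRowOnly : Prop :=
  ∀ f : UnitAddTorus (Fin 3) → EuclideanSpace ℝ (Fin 3),
    Torus.IsSmooth f → Torus.IsDivFree f → Torus.HasZeroMean f →
    ∀ (ν : ℕ → ℝ) (E ε : ℝ), (∀ j, 0 < ν j) → Tendsto ν atTop (𝓝 0) → 0 < ε →
    (∀ j : ℕ, ∃ R : ℝ, ∃ᶠ N in atTop, ∃ μ : Measure (Torus.energySpace (Fin 3)),
      IsProbabilityMeasure μ ∧ (∀ᵐ u ∂μ, IsLevel N u) ∧ (∀ᵐ u ∂μ, ‖u‖ ≤ R) ∧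
      IsPolyStationary (ν j) f N 2 μ ∧ Torus.ensembleEnergy μ ≤ E ∧ ε ≤ Torus.ensembleDissipation (ν j) μ) →
    ∃ E' ε' : ℝ, 0 < ε' ∧ ∀ j : ℕ, IsResolvedLoudFamilyAt f (ν j) E' ε'

/-- **The mean-row antecedent is witnessed at ZERO force** by the symmetric shear laws at the cutoff
frequency: `μ_{N,1}` at level `N`, viscosity `ν`, has energy `1/2`, support radius `1`, is 2-stationary
for `f = 0`, and dissipates `2π²N²ν ≥ 2π²` as soon as `N² ν ≥ 1`. [folklore] -/
theorem meanRow_antecedent_zero_force {ν : ℝ} (hν : 0 < ν) :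
    ∃ R : ℝ, ∃ᶠ N in atTop, ∃ μ : Measure (Torus.energySpace (Fin 3)),
      IsProbabilityMeasure μ ∧ (∀ᵐ u ∂μ, IsLevel N u) ∧ (∀ᵐ u ∂μ, ‖u‖ ≤ R) ∧
      IsPolyStationary ν (fun _ => 0) N 2 μ ∧ Torus.ensembleEnergy μ ≤ 1 / 2 ∧
      2 * Real.pi ^ 2 ≤ Torus.ensembleDissipation ν μ := by
  obtain ⟨M, hM⟩ := exists_nat_ge (1 / ν)
  refine ⟨1, (eventually_ge_atTop (M + 1)).frequently.mono fun N hN => ?_⟩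
  have hN0 : N ≠ 0 := by omega
  refine ⟨shearLaw N hN0 1, inferInstance, ae_isLevel_shearLaw hN0 1 le_rfl,
    by simpa using ae_norm_le_shearLaw hN0 1, isPolyStationary_two_shearLaw ν hN0 1 N,
    by rw [ensembleEnergy_shearLaw]; norm_num, ?_⟩
  rw [ensembleDissipation_shearLaw]
  have hNM : (1 / ν) ≤ (N : ℝ) := hM.trans (by exact_mod_cast (by omega : M ≤ N))
  have h1 : 1 ≤ (N : ℝ) * ν := by
    rw [div_le_iff₀ hν] at hNM; linarith
  have h1N : (1 : ℝ) ≤ N := by exact_mod_cast (show 1 ≤ N by omega)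
  have h2 : 1 ≤ (N : ℝ) ^ 2 * ν := by nlinarith
  have hpi : 0 < Real.pi ^ 2 := by positivity
  nlinarith

/-- **`¬ UniformResolutionMeanRowOnly`** — the antecedent's stationarity must be used at observables of
DEGREE ≥ 2 (`d ≥ 3`): with only the mean-flow row, the symmetric shear laws `½(δ_{S_{N,1}} + δ_{S_{N,−1}})`
at the cutoff shell (`f = 0`, `ν_j = 1/(j+1)`, `E = 1/2`, `ε = 2π²`) are loud with bounded support, while
NO resolved loud `d`-stationary family exists for `f = 0` (energy row). [folklore] -/
theorem not_uniformResolutionMeanRowOnly : ¬ UniformResolutionMeanRowOnly := fun h => by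
  obtain ⟨E', ε', hε', hj⟩ := h (fun _ => 0) (Torus.isSmooth_const _)
    (CubicParityLoud.Negative.isDivFree_const 0) (by simp [Torus.HasZeroMean])
    (fun j => 1 / ((j : ℝ) + 1)) (1 / 2) (2 * Real.pi ^ 2) (fun j => by positivity)
    tendsto_one_div_add_atTop_nhds_zero_nat (by positivity)
    (fun j => meanRow_antecedent_zero_force (by positivity))
  exact not_isResolvedLoudFamilyAt_zero_force hε' (hj 0)

/-- WEAKENING 2 of the antecedent (statement STRENGTHENED further): no stationarity at all in the
antecedent (only level, support, energy and dissipation clauses). -/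
def UniformResolutionWithoutStationarity : Prop :=
  ∀ f : UnitAddTorus (Fin 3) → EuclideanSpace ℝ (Fin 3),
    Torus.IsSmooth f → Torus.IsDivFree f → Torus.HasZeroMean f →
    ∀ (ν : ℕ → ℝ) (E ε : ℝ), (∀ j, 0 < ν j) → Tendsto ν atTop (𝓝 0) → 0 < ε →
    (∀ j : ℕ, ∃ R : ℝ, ∃ᶠ N in atTop, ∃ μ : Measure (Torus.energySpace (Fin 3)),
      IsProbabilityMeasure μ ∧ (∀ᵐ u ∂μ, IsLevel N u) ∧ (∀ᵐ u ∂μ, ‖u‖ ≤ R) ∧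
      Torus.ensembleEnergy μ ≤ E ∧ ε ≤ Torus.ensembleDissipation (ν j) μ) →
    ∃ E' ε' : ℝ, 0 < ε' ∧ ∀ j : ℕ, IsResolvedLoudFamilyAt f (ν j) E' ε'

/-- **`¬ UniformResolutionWithoutStationarity`** (corollary): `UniformResolution` is not a consequence of
its budget/level/support clauses — the implication needs the dynamics. [folklore] -/
theorem not_uniformResolutionWithoutStationarity : ¬ UniformResolutionWithoutStationarity := fun h =>
  not_uniformResolutionMeanRowOnly fun f hfs hfd hfz ν E ε hν hν0 hε hant =>
    h f hfs hfd hfz ν E ε hν hν0 hε fun j => by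
      obtain ⟨R, hfreq⟩ := hant j
      refine ⟨R, hfreq.mono ?_⟩
      rintro N ⟨μ, hp, hl, hs, -, hE, hD⟩
      exact ⟨μ, hp, hl, hs, hE, hD⟩

/-- WEAKENING 3 (of the hypotheses): `UniformResolution` without `0 < ε`. -/
def UniformResolutionWithoutEpsPos : Prop :=
  ∀ f : UnitAddTorus (Fin 3) → EuclideanSpace ℝ (Fin 3),
    Torus.IsSmooth f → Torus.IsDivFree f → Torus.HasZeroMean f →
    ∀ (ν : ℕ → ℝ) (E ε : ℝ), (∀ j, 0 < ν j) → Tendsto ν atTop (𝓝 0) →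
    (∀ j : ℕ, IsLoudFamilyAt f (ν j) E ε) →
    ∃ E' ε' : ℝ, 0 < ε' ∧ ∀ j : ℕ, IsResolvedLoudFamilyAt f (ν j) E' ε'

/-- The antecedent with `ε = 0`, `E = 0` is witnessed at `f = 0` by `δ₀` (all rows vanish identically,
at every level and every order). [folklore] -/
theorem isLoudFamilyAt_zero_force_dirac_zero {ν : ℝ} (hν : 0 ≤ ν) : IsLoudFamilyAt (fun _ => 0) ν 0 0 := by
  haveI : MeasurableSingletonClass (Torus.energySpace (Fin 3)) :=
    OpensMeasurableSpace.toMeasurableSingletonClass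
  refine ⟨0, Frequently.of_forall fun N d => ⟨Measure.dirac 0, inferInstance, ?_, ?_, ?_, ?_, ?_⟩⟩
  · rw [ae_dirac_eq]
    simp only [eventually_pure]
    exact fun k _ => mFourierCoeff_coe_zero k
  · rw [ae_dirac_eq]
    simp
  · intro m g P _ _
    refine ⟨Torus.integrable_dirac _ _, ?_⟩
    rw [integral_dirac]
    exact nsGeneratorPairing_zero_zero ν _
  · simp [Torus.ensembleEnergy, integral_dirac]
  · exact mul_nonneg hν ENNReal.toReal_nonneg

/-- **`0 < ε` is load-bearing** (`¬ UniformResolutionWithoutEpsPos`): with `ε = 0` the antecedent holds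
at `f = 0` (`δ₀`), and the conclusion — which still demands `ε' > 0` — fails at `f = 0`. [folklore] -/
theorem not_uniformResolutionWithoutEpsPos : ¬ UniformResolutionWithoutEpsPos := fun h => by
  obtain ⟨E', ε', hε', hj⟩ := h (fun _ => 0) (Torus.isSmooth_const _)
    (CubicParityLoud.Negative.isDivFree_const 0) (by simp [Torus.HasZeroMean])
    (fun j => 1 / ((j : ℝ) + 1)) 0 0 (fun j => by positivity) tendsto_one_div_add_atTop_nhds_zero_nat
    (fun j => isLoudFamilyAt_zero_force_dirac_zero (by positivity))
  exact not_isResolvedLoudFamilyAt_zero_force hε' (hj 0)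

/-- WEAKENING 4 (of the hypotheses): `UniformResolution` without `∀ j, 0 < ν j`. -/
def UniformResolutionWithoutNuPos : Prop :=
  ∀ f : UnitAddTorus (Fin 3) → EuclideanSpace ℝ (Fin 3),
    Torus.IsSmooth f → Torus.IsDivFree f → Torus.HasZeroMean f →
    ∀ (ν : ℕ → ℝ) (E ε : ℝ), Tendsto ν atTop (𝓝 0) → 0 < ε →
    (∀ j : ℕ, IsLoudFamilyAt f (ν j) E ε) →
    ∃ E' ε' : ℝ, 0 < ε' ∧ ∀ j : ℕ, IsResolvedLoudFamilyAt f (ν j) E' ε'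

/-- **`∀ j, 0 < ν j` is NOT load-bearing**: it follows from the antecedent and `0 < ε`
(`IsLoudFamilyAt.nu_pos`), so the weakening is EQUIVALENT to the crux. [folklore] -/
theorem uniformResolutionWithoutNuPos_iff : UniformResolutionWithoutNuPos ↔ UniformResolution := by
  rw [uniformResolution_iff]
  constructor
  · exact fun h f hfs hfd hfz ν E ε _ hν0 hε hant => h f hfs hfd hfz ν E ε hν0 hε hant
  · exact fun h f hfs hfd hfz ν E ε hν0 hε hant =>
      h f hfs hfd hfz ν E ε (fun j => (hant j).nu_pos hε) hν0 hε hant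

end LoadBearing

/-! ## E. Fixed viscosity: resolved loud families EXIST (laminar Kolmogorov Diracs) — the content of the
crux is uniformity of `(E', ε')` in `j`, i.e. `ν_j → 0` is where it lives -/

section FixedViscosity

/-- **A level-`κ₀` Dirac is resolved by the constant schedule `κ ≡ κ₀`** (its truncation at `κ₀` has the
same spectral enstrophy). [folklore] -/
theorem isResolved_dirac_of_isLevel {κ₀ : ℕ} {u : Torus.energySpace (Fin 3)} (hu : IsLevel κ₀ u) :
    IsResolved (fun _ => κ₀) (Measure.dirac u) :=
  -- the tree's `MomentLadder.Negative.isResolved_dirac_of_isLevel` (defeq twin vocabulary `IsResolved`)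
  MomentLadder.Negative.isResolved_dirac_of_isLevel hu fun _ => le_rfl

/-- **At FIXED viscosity resolved loud families exist at every level `N ≥ 1` and every order**: the
laminar Kolmogorov Dirac `δ_{[K_a]}`, `a = (4π²ν)⁻¹`, force `K_1 = cos(2πx₁)e₀`, resolved by `κ ≡ 1`,
support radius `a`, energy `a²/2`, dissipation `(8π²ν)⁻¹` (`QuarticGate.Negative.Laminar`). So the
conclusion of `UniformResolution` is satisfiable at each `j` separately — with `E'_j = (4π²ν_j)⁻²/2 → ∞`;
the crux's content is the `j`-UNIFORM budget pair, i.e. it lives at `ν_j → 0`. [folklore] -/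
theorem isResolvedLoudFamilyAt_laminar {ν : ℝ} (hν : 0 < ν) :
    IsResolvedLoudFamilyAt (kolField 1) ν ((4 * Real.pi ^ 2 * ν)⁻¹ ^ 2 / 2) (8 * Real.pi ^ 2 * ν)⁻¹ := by
  haveI : MeasurableSingletonClass (Torus.energySpace (Fin 3)) :=
    OpensMeasurableSpace.toMeasurableSingletonClass
  have hpi : 0 < Real.pi := Real.pi_pos
  set a : ℝ := (4 * Real.pi ^ 2 * ν)⁻¹ with ha
  have ha0 : 0 < a := by positivity
  have hforce : kolField 1 = kolField (4 * Real.pi ^ 2 * ν * a) := by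
    rw [ha, mul_inv_cancel₀ (by positivity)]
  refine ⟨a, fun _ => 1, (eventually_ge_atTop 1).frequently.mono fun N hN d => ?_⟩
  obtain ⟨⟨hprob, hlev, -, -, hE, hε⟩, -⟩ := isQuarticWitness_dirac_kolState hν hN
  refine ⟨Measure.dirac (kolState a), hprob, hlev, ?_, isResolved_dirac_of_isLevel (isLevel_kolState a le_rfl),
    ?_, hE, hε⟩
  · rw [ae_dirac_eq]
    simp only [eventually_pure]
    refine (sq_le_sq₀ (norm_nonneg _) ha0.le).1 ?_
    rw [norm_sq_kolState]
    nlinarith [sq_nonneg a]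
  · rw [hforce]
    exact isPolyStationary_dirac_kolState ν a N d

/-- WEAKENING 5 (of the hypotheses): `UniformResolution` without `ν_j → 0`. NOT refuted: at constant
viscosity the laminar instance satisfies antecedent AND conclusion (next theorem); a refutation of this
weakening would again need a non-laminar loud family. Recorded as the statement only. -/
def UniformResolutionWithoutVanishingViscosity : Prop :=
  ∀ f : UnitAddTorus (Fin 3) → EuclideanSpace ℝ (Fin 3),
    Torus.IsSmooth f → Torus.IsDivFree f → Torus.HasZeroMean f →
    ∀ (ν : ℕ → ℝ) (E ε : ℝ), (∀ j, 0 < ν j) → 0 < ε →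
    (∀ j : ℕ, IsLoudFamilyAt f (ν j) E ε) →
    ∃ E' ε' : ℝ, 0 < ε' ∧ ∀ j : ℕ, IsResolvedLoudFamilyAt f (ν j) E' ε'

/-- The laminar instance of the weakening: constant viscosity `ν₀`, force `K_1`, antecedent and conclusion
both hold with the same budgets. [folklore] -/
theorem laminar_instance_constant_viscosity {ν₀ : ℝ} (hν : 0 < ν₀) :
    (∀ _j : ℕ, IsLoudFamilyAt (kolField 1) ν₀ ((4 * Real.pi ^ 2 * ν₀)⁻¹ ^ 2 / 2) (8 * Real.pi ^ 2 * ν₀)⁻¹) ∧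
    ∃ E' ε' : ℝ, 0 < ε' ∧ ∀ _j : ℕ, IsResolvedLoudFamilyAt (kolField 1) ν₀ E' ε' :=
  ⟨fun _ => (isResolvedLoudFamilyAt_laminar hν).isLoudFamilyAt, _, _,
    by have := Real.pi_pos; positivity, fun _ => isResolvedLoudFamilyAt_laminar hν⟩

end FixedViscosity

/-! ## H. How a PROOF would go: the resolution criterion applied to the conclusion body -/

section Criterion

/-- **Sufficient condition for the conclusion of the crux at one viscosity** (`Negative/ResolutionCriterion.lean`):
laws `μ ∈ 𝓕` — level-`N` for infinitely many `N`, supported in one ball, stationary at EVERY order (e.g. the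
Galerkin-invariant laws produced by MomentClosure), loud with budgets `(E, ε)` — whose family has uniformly
integrable enstrophy and a uniform weighted `H²` bound (some exponent `p`), give `IsResolvedLoudFamilyAt f ν E ε`.
The weighted bound is the Foias–Guillopé–Temam estimate (N-uniform for invariant level-`N` laws by the Agmon
bootstrap of `Negative/SteadyResolved.lean`); the uniform integrability is the open part. [folklore] -/
theorem isResolvedLoudFamilyAt_of_criterion {f : UnitAddTorus (Fin 3) → EuclideanSpace ℝ (Fin 3)}
    {ν E ε R : ℝ} {𝓕 : Set (Measure (Torus.energySpace (Fin 3)))} {p : ℕ}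
    (hUI : UniformlyIntegrableEnstrophy 𝓕) (hH2 : WeightedH2Bound p 𝓕)
    (h : ∃ᶠ N in atTop, ∃ μ ∈ 𝓕, IsProbabilityMeasure μ ∧ (∀ᵐ u ∂μ, IsLevel N u) ∧ (∀ᵐ u ∂μ, ‖u‖ ≤ R) ∧
      (∀ d, IsPolyStationary ν f N d μ) ∧ Torus.ensembleEnergy μ ≤ E ∧ ε ≤ Torus.ensembleDissipation ν μ) :
    IsResolvedLoudFamilyAt f ν E ε := by
  obtain ⟨κ, hκ⟩ := exists_isResolved_of_uniformlyIntegrable_of_weightedH2 hUI hH2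
  refine ⟨R, κ, h.mono ?_⟩
  rintro N ⟨μ, hμ, hp, hl, hs, hst, hE, hD⟩ d
  exact ⟨μ, hp, hl, hs, hκ μ hμ, hst d, hE, hD⟩

/-- **WHERE THE CRUX EXACTLY LIVES** (`Negative/FGTBound.lean` + `Negative/ResolutionCriterion.lean`): at
viscosity `ν > 0` with a smooth force, a family of FGT-stationary laws (e.g. the Galerkin-INVARIANT loud laws of
MomentClosure, level by level) that are level-`N` for infinitely many `N`, supported in one ball, stationary at
every order and loud with budgets `(E, ε)` gives the conclusion body `IsResolvedLoudFamilyAt f ν E ε` AS SOON AS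
the family has UNIFORMLY INTEGRABLE ENSTROPHY. Hence `UniformResolution ⇐ MomentClosure ∧ (∀ j, uniform
integrability of the enstrophy over a loud invariant family at ν_j)`; and a refutation must force NON-uniformly-
integrable (intermittent) enstrophy on every loud invariant family of its force at some `ν_j`. [folklore] -/
theorem isResolvedLoudFamilyAt_of_fgt_of_uniformlyIntegrable {f : UnitAddTorus (Fin 3) → EuclideanSpace ℝ (Fin 3)}
    (hf : Torus.IsSmooth f) {ν E ε R : ℝ} (hν : 0 < ν) {𝓕 : Set (Measure (Torus.energySpace (Fin 3)))}
    (h𝓕 : ∀ μ ∈ 𝓕, ∃ N, IsFGTStationary ν f N μ) (hUI : UniformlyIntegrableEnstrophy 𝓕)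
    (h : ∃ᶠ N in atTop, ∃ μ ∈ 𝓕, IsProbabilityMeasure μ ∧ (∀ᵐ u ∂μ, IsLevel N u) ∧ (∀ᵐ u ∂μ, ‖u‖ ≤ R) ∧
      (∀ d, IsPolyStationary ν f N d μ) ∧ Torus.ensembleEnergy μ ≤ E ∧ ε ≤ Torus.ensembleDissipation ν μ) :
    IsResolvedLoudFamilyAt f ν E ε :=
  isResolvedLoudFamilyAt_of_criterion hUI (weightedH2Bound_four_of_fgt hν hf h𝓕) h

end Criterion

/-! ## F. Why it resists — the STEADY sector is resolved (unconditionally, `Negative/SteadyResolved.lean`), so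
`¬ UniformResolution` lives in "ensemble-loud but steady-quiet, universally leaking" worlds -/

section Steady

/-- The Dirac mass at a Galerkin steady state (`IsGalerkinSteady` of `Negative/SteadyStates.lean`: every
level-`N` band test annihilates the generator row) is `d`-stationary at every order, for a smooth force
(rows of polynomial tests are finite combinations of band-test rows). [folklore] -/
theorem isPolyStationary_dirac_of_isGalerkinSteady {ν : ℝ} {f : UnitAddTorus (Fin 3) → EuclideanSpace ℝ (Fin 3)}
    (hf : Torus.IsSmooth f) {N : ℕ} {u : Torus.energySpace (Fin 3)} (hu : IsGalerkinSteady ν f N u) (d : ℕ) :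
    IsPolyStationary ν f N d (Measure.dirac u) := by
  haveI : MeasurableSingletonClass (Torus.energySpace (Fin 3)) :=
    OpensMeasurableSpace.toMeasurableSingletonClass
  intro m g P hg _
  refine ⟨Torus.integrable_dirac _ _, ?_⟩
  rw [integral_dirac]
  exact hu.row_polyGrad hf g P hg

/-- LOUD STEADY FAMILY at one viscosity: bounded-energy Galerkin steady states with dissipation `≥ ε`,
in a common ball, at infinitely many levels (the body of a Galerkin STEADY zeroth law, cf. route
MirrorVariety's `GalerkinSteadyZerothLaw`). -/
def IsLoudSteadyFamilyAt (f : UnitAddTorus (Fin 3) → EuclideanSpace ℝ (Fin 3)) (ν E ε : ℝ) : Prop :=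
  ∃ R : ℝ, ∃ᶠ N in atTop, ∃ u : Torus.energySpace (Fin 3), IsLevel N u ∧ ‖u‖ ≤ R ∧
    IsGalerkinSteady ν f N u ∧ ‖u‖ ^ 2 ≤ E ∧
    ε ≤ ν * (Torus.eGradNormSq ((u.1 : L2T3) : UnitAddTorus (Fin 3) → EuclideanSpace ℝ (Fin 3))).toReal

/-- **STEADY DIRACS ARE RESOLVED, UNIFORMLY IN THE LEVEL** (restated with `IsResolved`; the `N`-uniform
`H²` bound for Galerkin steady states of `Negative/SteadyResolved.lean`): for smooth `f`, `ν > 0` and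
every radius `R` ONE schedule `κ` resolves the Dirac mass at every level-`N` Galerkin steady state in the
`R`-ball, for every `N`. [folklore] -/
theorem steadyDiracsResolved {f : UnitAddTorus (Fin 3) → EuclideanSpace ℝ (Fin 3)} (hf : Torus.IsSmooth f)
    {ν : ℝ} (hν : 0 < ν) (R : ℝ) :
    ∃ κ : ℕ → ℕ, ∀ (N : ℕ) (u : Torus.energySpace (Fin 3)),
      IsLevel N u → ‖u‖ ≤ R → IsGalerkinSteady ν f N u → IsResolved κ (Measure.dirac u) :=
  exists_schedule_steady_resolved hν hf R

/-- **The steady sector satisfies the conclusion, unconditionally**: a loud STEADY family at viscosity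
`ν > 0` (smooth force) IS a RESOLVED loud `d`-stationary family with the same budgets. Hence if the
antecedent of `UniformResolution` is ever witnessed by Diracs at Galerkin steady states (a Galerkin steady
zeroth law along `ν_j`), the conclusion holds for that `(f, ν)` — a refutation must come from genuinely
statistical (non-Dirac) loud families for a force WITHOUT loud bounded-energy steady states, all of whose
loud invariant laws leak enstrophy to the cutoff `N`-frequently at some fixed `ν_j`. [folklore] -/
theorem isResolvedLoudFamilyAt_of_steady {f : UnitAddTorus (Fin 3) → EuclideanSpace ℝ (Fin 3)}
    (hf : Torus.IsSmooth f) {ν E ε : ℝ} (hν : 0 < ν) (h : IsLoudSteadyFamilyAt f ν E ε) :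
    IsResolvedLoudFamilyAt f ν E ε := by
  haveI : MeasurableSingletonClass (Torus.energySpace (Fin 3)) :=
    OpensMeasurableSpace.toMeasurableSingletonClass
  obtain ⟨R, hfreq⟩ := h
  obtain ⟨κ, hκ⟩ := steadyDiracsResolved hf hν R
  refine ⟨R, κ, hfreq.mono ?_⟩
  rintro N ⟨u, hlev, hR, hst, hE, hε⟩ d
  refine ⟨Measure.dirac u, inferInstance, ?_, ?_, hκ N u hlev hR hst,
    isPolyStationary_dirac_of_isGalerkinSteady hf hst d, ?_, ?_⟩
  · rw [ae_dirac_eq]; simpa using hlev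
  · rw [ae_dirac_eq]; simpa using hR
  · rw [Torus.ensembleEnergy, integral_dirac]; exact hE
  · unfold Torus.ensembleDissipation Torus.ensembleEnstrophy
    rw [lintegral_dirac]; exact hε

/-- Consequently `¬ UniformResolution` forces, for its witnessing force and viscosities, the FAILURE of the
steady zeroth law with the witnessing budgets at some `j`: no loud steady family with budgets `(E', ε')`
for every budget pair — in particular not with the antecedent's own `(E, ε)`. [folklore] -/
theorem not_isLoudSteadyFamilyAt_of_not_uniformResolution (h : ¬ UniformResolution) :
    ∃ f : UnitAddTorus (Fin 3) → EuclideanSpace ℝ (Fin 3),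
      Torus.IsSmooth f ∧ Torus.IsDivFree f ∧ Torus.HasZeroMean f ∧
      ∃ (ν : ℕ → ℝ) (E ε : ℝ), (∀ j, 0 < ν j) ∧ Tendsto ν atTop (𝓝 0) ∧ 0 < ε ∧
      (∀ j : ℕ, IsLoudFamilyAt f (ν j) E ε) ∧
      ∀ E' ε' : ℝ, 0 < ε' → ∃ j : ℕ, ¬ IsLoudSteadyFamilyAt f (ν j) E' ε' := by
  obtain ⟨f, hfs, hfd, hfz, ν, E, ε, hν, hν0, hε, hloud, hno⟩ := not_uniformResolution_iff.1 h
  refine ⟨f, hfs, hfd, hfz, ν, E, ε, hν, hν0, hε, hloud, fun E' ε' hε' => ?_⟩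
  obtain ⟨j, hj⟩ := hno E' ε' hε'
  exact ⟨j, fun hs => hj (isResolvedLoudFamilyAt_of_steady hfs (hν j) hs)⟩

end Steady

/-! ## G. The refutation scenario, restated (nothing remains sorried) -/

section Scenario

/-- THE ONLY REFUTATION SCENARIO, as a statement: a force with a `d`-wise Galerkin-ensemble zeroth law whose
every resolved loud family fails at some viscosity — by §A this is literally `¬ UniformResolution`; by §F the
force has NO loud bounded-energy Galerkin steady states along `ν_j` for any budgets
(`not_isLoudSteadyFamilyAt_of_not_uniformResolution`); by §H every loud invariant family of it has
non-uniformly-integrable enstrophy at some `ν_j` (granted the FGT weighted bound). Physically: statistics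
thermalising at the truncation scale at FIXED ν (truncated-Euler-like bottleneck) FORCED on every loud ensemble —
failure of the mean energy EQUALITY for every loud Galerkin-limit stationary statistical solution of that force.
No construction of either half is within reach (the first half alone is the zeroth law). [folklore] -/
theorem refutation_scenario_iff_not_uniformResolution :
    (∃ f : UnitAddTorus (Fin 3) → EuclideanSpace ℝ (Fin 3),
      Torus.IsSmooth f ∧ Torus.IsDivFree f ∧ Torus.HasZeroMean f ∧
      ∃ (ν : ℕ → ℝ) (E ε : ℝ), (∀ j, 0 < ν j) ∧ Tendsto ν atTop (𝓝 0) ∧ 0 < ε ∧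
      (∀ j : ℕ, IsLoudFamilyAt f (ν j) E ε) ∧
      ∀ E' ε' : ℝ, 0 < ε' → ∃ j : ℕ, ¬ IsResolvedLoudFamilyAt f (ν j) E' ε') ↔ ¬ UniformResolution :=
  not_uniformResolution_iff.symm

end Scenario


/-! ## RB. THE ROW BARRIER (generation 2) -/

/-! ## 1. Single-shell shear atoms: coefficients, truncations, enstrophy, palinstrophy, the two rows -/

section Atoms

variable {M n : ℕ} (hM : M ≠ 0) (a : ℝ)

/-- `realTrigPoly` over a larger frequency set with vanishing extra coefficients. [folklore] -/
theorem realTrigPoly_subset {S S' : Finset (Fin 3 → ℤ)} (hSS' : S ⊆ S') {c : (Fin 3 → ℤ) → EuclideanSpace ℂ (Fin 3)}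
    (h : ∀ k ∈ S', k ∉ S → c k = 0) : Torus.realTrigPoly S' c = Torus.realTrigPoly S c := by
  rw [Torus.realTrigPoly_eq_comp, Torus.realTrigPoly_eq_comp, Torus.trigPoly_subset hSS' h]

/-- The shear shell sits in the ball of every level `n ≥ M`. [folklore] -/
theorem shearSet_subset_freqBall (hMn : M ≤ n) : shearSet M ⊆ Torus.freqBall n := fun k hk =>
  Torus.mem_freqBall.2 (by
    rw [freqNormSq_of_mem_shearSet hk]
    exact_mod_cast Nat.pow_le_pow_left hMn 2)

/-- Fourier coefficients of the shear state: `kolCoeff a` on the shell, `0` off it. [folklore] -/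
theorem coef_shearState (k : Fin 3 → ℤ) :
    coef (shearState M hM a) k = if k ∈ shearSet M then kolCoeff a k else 0 := by
  unfold coef
  rw [mFourierCoeff_congr_ae (coe_shearState_ae hM a)]
  exact Torus.mFourierCoeff_realTrigPoly (neg_mem_shearSet M) (isConjSymm_kolCoeff a) k

/-- The level-`n` truncation of the shear state IS the shear field (`M ≤ n`). [folklore] -/
theorem trunc_shearState (hMn : M ≤ n) : trunc n (shearState M hM a) = shearField M a := by
  rw [trunc_eq, realTrigPoly_subset (shearSet_subset_freqBall hMn) (c := coef (shearState M hM a))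
    (fun k _ hk => by rw [coef_shearState, if_neg hk])]
  exact Torus.realTrigPoly_congr fun k hk => by rw [coef_shearState, if_pos hk]

/-- `−Δ` of the truncation of the shear state is the shear field with amplitude `4π²M²a`. [folklore] -/
theorem lapTrunc_shearState (hMn : M ≤ n) :
    lapTrunc n (shearState M hM a) = shearField M (4 * Real.pi ^ 2 * (M : ℝ) ^ 2 * a) := by
  have hcoef : ∀ k, lapCoef (shearState M hM a) k =
      if k ∈ shearSet M then kolCoeff (4 * Real.pi ^ 2 * (M : ℝ) ^ 2 * a) k else 0 := by
    intro k
    simp only [lapCoef, coef_shearState]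
    split_ifs with hk
    · rw [freqNormSq_of_mem_shearSet hk, kolCoeff_mul]
    · rw [smul_zero]
  unfold lapTrunc
  rw [realTrigPoly_subset (shearSet_subset_freqBall hMn) (c := lapCoef (shearState M hM a))
    (fun k _ hk => by rw [hcoef, if_neg hk])]
  exact Torus.realTrigPoly_congr fun k hk => by rw [hcoef, if_pos hk]

/-- The weighted coefficient sums of a shear state over any ball containing its shell. [folklore] -/
theorem sum_freqBall_coef_shearState (hMn : M ≤ n) (φ : ℝ → ℝ) :
    ∑ k ∈ Torus.freqBall n, φ (Torus.freqNormSq k) * ‖coef (shearState M hM a) k‖ ^ 2 =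
      2 * (φ ((M : ℝ) ^ 2) * (a ^ 2 / 4)) := by
  rw [← Finset.sum_subset (shearSet_subset_freqBall hMn) fun k _ hk => by
    rw [coef_shearState, if_neg hk, norm_zero]; ring]
  rw [Finset.sum_congr rfl fun k hk => by
    rw [coef_shearState, if_pos hk, freqNormSq_of_mem_shearSet hk, norm_kolCoeff], Finset.sum_const, card_shearSet hM]
  simp only [nsmul_eq_mul, Nat.cast_ofNat, div_pow, sq_abs]
  ring

/-- Enstrophy of the shear atom: `G = 2π²M²a²`. [folklore] -/
theorem gradSq_shearState (hMn : M ≤ n) : gradSq n (shearState M hM a) = 2 * Real.pi ^ 2 * (M : ℝ) ^ 2 * a ^ 2 := by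
  unfold gradSq
  rw [sum_freqBall_coef_shearState hM a hMn (fun t => t)]
  ring

/-- Palinstrophy of the shear atom: `‖Δū‖² = 8π⁴M⁴a²`. [folklore] -/
theorem lapSq_shearState (hMn : M ≤ n) : lapSq n (shearState M hM a) = 8 * Real.pi ^ 4 * (M : ℝ) ^ 4 * a ^ 2 := by
  unfold lapSq
  rw [sum_freqBall_coef_shearState hM a hMn (fun t => t ^ 2)]
  ring

/-- The FGT weight of the shear atom. [folklore] -/
theorem fgtWeight_shearState (hMn : M ≤ n) :
    fgtWeight n (shearState M hM a) = ((1 + 2 * Real.pi ^ 2 * (M : ℝ) ^ 2 * a ^ 2) ^ 4)⁻¹ := by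
  rw [fgtWeight, gradSq_shearState hM a hMn]

/-- Shear fields on the same shell: `∫⟪S_{M,c}, S_{M,b}⟫ = cb/2`. [folklore] -/
theorem integral_inner_shearField_same (hM : M ≠ 0) (c b : ℝ) :
    ∫ x, ⟪shearField M c x, shearField M b x⟫_ℝ = c * b / 2 := by
  have h1 : ∀ x, ⟪shearField M c x, shearField M b x⟫_ℝ = (c * b) * ‖shearField M 1 x‖ ^ 2 := fun x => by
    rw [show c = c * 1 by ring, shearField_mul, show b = b * 1 by ring, shearField_mul, inner_smul_left,
      inner_smul_right, real_inner_self_eq_norm_sq]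
    simp only [mul_one, RCLike.conj_to_real]
    ring
  simp_rw [h1]
  rw [integral_const_mul, integral_norm_sq_shearField hM]
  ring

/-- Shear fields on different shells are orthogonal. [folklore] -/
theorem integral_inner_shearField_of_ne {M M' : ℕ} (hMM' : M ≠ M') (c b : ℝ) :
    ∫ x, ⟪shearField M c x, shearField M' b x⟫_ℝ = 0 := by
  rw [shearField, Torus.integral_inner_realTrigPoly_left (neg_mem_shearSet M) (isConjSymm_kolCoeff c)
    ((isSmooth_shearField M' b).memLp 2)]
  refine Finset.sum_eq_zero fun k hk => ?_
  have hk' : k ∉ shearSet M' := fun hk' => hMM' (by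
    have h1 := freqNormSq_of_mem_shearSet hk
    rw [freqNormSq_of_mem_shearSet hk'] at h1
    exact_mod_cast (sq_eq_sq₀ (Nat.cast_nonneg M') (Nat.cast_nonneg M)).1 h1 |>.symm)
  change (inner ℂ (kolCoeff c k) (UnitAddTorus.mFourierCoeff (EuclideanSpace.complexify ∘ shearField M' b) k)).re = 0
  rw [mFourierCoeff_shearField_eq_zero b hk', inner_zero_right, Complex.zero_re]

/-- `∫⟪S_{1,c}, S_{M,b}⟫ = cb/2` if `M = 1`, else `0`. [folklore] -/
theorem integral_inner_shearField_one (c b : ℝ) :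
    ∫ x, ⟪shearField 1 c x, shearField M b x⟫_ℝ = if M = 1 then c * b / 2 else 0 := by
  split_ifs with h
  · subst h; exact integral_inner_shearField_same one_ne_zero c b
  · exact integral_inner_shearField_of_ne (Ne.symm h) c b

variable {ν : ℝ}

/-- **THE ENERGY ROW OF A SHEAR ATOM** at force `S_{1,c}`: `⟨F(U), ū⟩ = [M = 1] ca/2 − 2π²νM²a²`. [folklore] -/
theorem energyRow_shearState (ν c : ℝ) (hMn : M ≤ n) :
    Torus.nsGeneratorPairing ν (shearField 1 c) (shearState M hM a) (trunc n (shearState M hM a)) =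
      (if M = 1 then c * a / 2 else 0) - ν * (2 * Real.pi ^ 2 * (M : ℝ) ^ 2 * a ^ 2) := by
  rw [nsGeneratorPairing_trunc_eq ν (isSmooth_shearField 1 c) (isLevel_shearState hM a hMn)]
  change (∫ x, ⟪shearField 1 c x, trunc n (shearState M hM a) x⟫_ℝ) - ν * gradSq n (shearState M hM a) = _
  rw [trunc_shearState hM a hMn, integral_inner_shearField_one, gradSq_shearState hM a hMn]

/-- **THE ENSTROPHY-TEST ROW OF A SHEAR ATOM** (test field `z = −Δū`, no stretching): `⟨F(U), z⟩ = 4π²M² ⟨F(U), ū⟩`.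
[folklore] -/
theorem enstrophyRow_shearState (ν c : ℝ) (hMn : M ≤ n) :
    Torus.nsGeneratorPairing ν (shearField 1 c) (shearState M hM a) (lapTrunc n (shearState M hM a)) =
      4 * Real.pi ^ 2 * (M : ℝ) ^ 2 * ((if M = 1 then c * a / 2 else 0) - ν * (2 * Real.pi ^ 2 * (M : ℝ) ^ 2 * a ^ 2)) := by
  rw [nsGeneratorPairing_lapTrunc_eq ν (isSmooth_shearField 1 c) (isLevel_shearState hM a hMn), ← lapSq_eq,
    lapSq_shearState hM a hMn, trunc_shearState hM a hMn, lapTrunc_shearState hM a hMn, integral_inner_shearField_one]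
  simp_rw [convect_shearField_self, inner_zero_left, integral_zero]
  split_ifs <;> ring

/-- **THE FGT INTEGRAND OF A SHEAR ATOM**: `(1+G)⁻⁴⟨F(U), z⟩`, explicitly. [folklore] -/
theorem fgtRow_shearState (ν c : ℝ) (hMn : M ≤ n) :
    fgtWeight n (shearState M hM a) *
        Torus.nsGeneratorPairing ν (shearField 1 c) (shearState M hM a) (lapTrunc n (shearState M hM a)) =
      ((1 + 2 * Real.pi ^ 2 * (M : ℝ) ^ 2 * a ^ 2) ^ 4)⁻¹ *
        (4 * Real.pi ^ 2 * (M : ℝ) ^ 2 * ((if M = 1 then c * a / 2 else 0) - ν * (2 * Real.pi ^ 2 * (M : ℝ) ^ 2 * a ^ 2))) := by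
  rw [fgtWeight_shearState hM a hMn, enstrophyRow_shearState hM a ν c hMn]

end Atoms

/-! ## 2. Weighted atomic laws on `H` (finitely many Dirac masses with real weights) -/

section Atomic

variable {ι : Type*} [Fintype ι] (w : ι → ℝ) (U : ι → Torus.energySpace (Fin 3))

/-- The weighted atomic law `Σᵢ wᵢ δ_{Uᵢ}` (weights entered through `ENNReal.ofReal`). -/
def atomic : Measure (Torus.energySpace (Fin 3)) :=
  ∑ i, ENNReal.ofReal (w i) • Measure.dirac (U i)

/-- Lower Lebesgue integrals against a weighted atomic law. [folklore] -/
theorem lintegral_atomic (G : Torus.energySpace (Fin 3) → ℝ≥0∞) :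
    ∫⁻ u, G u ∂(atomic w U) = ∑ i, ENNReal.ofReal (w i) * G (U i) := by
  haveI : MeasurableSingletonClass (Torus.energySpace (Fin 3)) := OpensMeasurableSpace.toMeasurableSingletonClass
  rw [atomic, lintegral_finsetSum_measure]
  exact Finset.sum_congr rfl fun i _ => by rw [lintegral_smul_measure, lintegral_dirac, smul_eq_mul]

/-- Every real observable is integrable against a weighted atomic law. [folklore] -/
theorem integrable_atomic (F : Torus.energySpace (Fin 3) → ℝ) : Integrable F (atomic w U) := by
  rw [atomic, integrable_finsetSum_measure]
  exact fun i _ => (Torus.integrable_dirac _ _).smul_measure ENNReal.ofReal_ne_top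

/-- Bochner integrals against a weighted atomic law with nonnegative weights. [folklore] -/
theorem integral_atomic (hw : ∀ i, 0 ≤ w i) (F : Torus.energySpace (Fin 3) → ℝ) :
    ∫ u, F u ∂(atomic w U) = ∑ i, w i * F (U i) := by
  haveI : MeasurableSingletonClass (Torus.energySpace (Fin 3)) := OpensMeasurableSpace.toMeasurableSingletonClass
  rw [atomic, integral_finsetSum_measure fun i _ => (Torus.integrable_dirac _ _).smul_measure ENNReal.ofReal_ne_top]
  exact Finset.sum_congr rfl fun i _ => by
    rw [integral_smul_measure, integral_dirac, ENNReal.toReal_ofReal (hw i), smul_eq_mul]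

/-- Almost-sure statements for a weighted atomic law: it suffices to check the atoms. [folklore] -/
theorem ae_atomic {p : Torus.energySpace (Fin 3) → Prop} (h : ∀ i, p (U i)) : ∀ᵐ u ∂(atomic w U), p u := by
  haveI : MeasurableSingletonClass (Torus.energySpace (Fin 3)) := OpensMeasurableSpace.toMeasurableSingletonClass
  rw [atomic, ae_finsetSum_measure_iff]
  intro i _
  refine Measure.ae_smul_measure ?_ _
  rw [ae_dirac_eq]
  exact h i

/-- Total mass of a weighted atomic law with nonnegative weights summing to one. [folklore] -/
theorem isProbabilityMeasure_atomic (hw : ∀ i, 0 ≤ w i) (hsum : ∑ i, w i = 1) :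
    IsProbabilityMeasure (atomic w U) := by
  refine ⟨?_⟩
  have h := lintegral_atomic w U (fun _ => 1)
  simp only [lintegral_one, mul_one] at h
  rw [h, ← ENNReal.ofReal_sum_of_nonneg fun i _ => hw i, hsum, ENNReal.ofReal_one]

/-- Mean energy of a weighted atomic law. [folklore] -/
theorem ensembleEnergy_atomic (hw : ∀ i, 0 ≤ w i) :
    Torus.ensembleEnergy (atomic w U) = ∑ i, w i * ‖U i‖ ^ 2 :=
  integral_atomic w U hw _

/-- Mean enstrophy of a weighted atomic law. [folklore] -/
theorem ensembleEnstrophy_atomic :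
    Torus.ensembleEnstrophy (atomic w U) =
      ∑ i, ENNReal.ofReal (w i) * Torus.eGradNormSq (((U i).1 : L2T3) : UnitAddTorus (Fin 3) → EuclideanSpace ℝ (Fin 3)) :=
  lintegral_atomic w U _

end Atomic

/-! ## 3. The weights and masses of the leak laws (pure real arithmetic) -/

section Weights

/-- FGT weight of the production atom `[S_{1,1/2}]` (`G = π²/2`). -/
def wA : ℝ := ((1 + Real.pi ^ 2 / 2) ^ 4)⁻¹

/-- FGT weight of the low consumption atom `[S_{1,−1/4}]` (`G = π²/8`). -/
def wC : ℝ := ((1 + Real.pi ^ 2 / 8) ^ 4)⁻¹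

/-- FGT weight of the cutoff atom `[S_{m+2,1}]` (`G = 2π²(m+2)²`). -/
def wB (m : ℕ) : ℝ := ((1 + 2 * Real.pi ^ 2 * ((m + 2 : ℕ) : ℝ) ^ 2) ^ 4)⁻¹

/-- The (vanishing) weighted palinstrophy defect of the cutoff atom: `e_m = (m+2)² w_B`. -/
def leakE (m : ℕ) : ℝ := ((m + 2 : ℕ) : ℝ) ^ 2 * wB m

/-- Mass of the low consumption atom: `p_C = 2(w_A − e_m)/(5(w_C − w_A))`. -/
def leakMassC (m : ℕ) : ℝ := 2 * (wA - leakE m) / (5 * (wC - wA))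

/-- Mass of the production atom: `p_A = 1/2 + (5/4) p_C`. -/
def leakMassA (m : ℕ) : ℝ := 1 / 2 + 5 / 4 * leakMassC m

/-- Mass of the cutoff atom: `(8(m+2)²)⁻¹`. -/
def leakMassB (m : ℕ) : ℝ := (8 * ((m + 2 : ℕ) : ℝ) ^ 2)⁻¹

/-- Mass of the null atom (the rest). -/
def leakMass0 (m : ℕ) : ℝ := 1 - leakMassA m - leakMassC m - leakMassB m

/-- The four weights, indexed. -/
def leakWeight (m : ℕ) : Fin 4 → ℝ := ![leakMassA m, leakMassC m, leakMassB m, leakMass0 m]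

/-! ### Elementary inequalities between the weights -/

/-- `9 < π²`. [folklore] -/
theorem pi_sq_gt_nine : 9 < Real.pi ^ 2 := by nlinarith [Real.pi_gt_three]

/-- `π² < 16`. [folklore] -/
theorem pi_sq_lt_sixteen : Real.pi ^ 2 < 16 := by nlinarith [Real.pi_lt_four, Real.pi_pos]

/-- `0 < w_A`. [folklore] -/
theorem wA_pos : 0 < wA := by unfold wA; positivity

/-- `0 < w_C`. [folklore] -/
theorem wC_pos : 0 < wC := by unfold wC; positivity

/-- `0 < w_B`. [folklore] -/
theorem wB_pos (m : ℕ) : 0 < wB m := by unfold wB; positivity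

/-- `w_C ≥ 3 w_A` (the low consumer sits at lower enstrophy than the producer). [folklore] -/
theorem three_mul_wA_le_wC : 3 * wA ≤ wC := by
  have h9 := pi_sq_gt_nine
  have h16 := pi_sq_lt_sixteen
  unfold wA wC
  have hC : (1 + Real.pi ^ 2 / 8) ^ 4 ≤ 81 := by
    have h1 : 1 + Real.pi ^ 2 / 8 ≤ 3 := by linarith
    have h0 : 0 ≤ 1 + Real.pi ^ 2 / 8 := by positivity
    calc (1 + Real.pi ^ 2 / 8) ^ 4 ≤ 3 ^ 4 := pow_le_pow_left₀ h0 h1 4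
      _ = 81 := by norm_num
  have hA : (915 : ℝ) ≤ (1 + Real.pi ^ 2 / 2) ^ 4 := by
    have h1 : (11 / 2 : ℝ) ≤ 1 + Real.pi ^ 2 / 2 := by linarith
    calc (915 : ℝ) ≤ (11 / 2) ^ 4 := by norm_num
      _ ≤ (1 + Real.pi ^ 2 / 2) ^ 4 := pow_le_pow_left₀ (by norm_num) h1 4
  have hCpos : 0 < (1 + Real.pi ^ 2 / 8) ^ 4 := by positivity
  rw [show 3 * ((1 + Real.pi ^ 2 / 2) ^ 4)⁻¹ = 3 / (1 + Real.pi ^ 2 / 2) ^ 4 by ring, inv_eq_one_div,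
    div_le_div_iff₀ (by positivity) hCpos]
  nlinarith

/-- `w_A < w_C`. [folklore] -/
theorem wA_lt_wC : wA < wC := by linarith [three_mul_wA_le_wC, wA_pos]

/-- The cutoff defect is below the producer's weight: `e_m < w_A` (so `p_C > 0`). [folklore] -/
theorem leakE_lt_wA (m : ℕ) : leakE m < wA := by
  have h9 := pi_sq_gt_nine
  unfold leakE wB wA
  set x : ℝ := Real.pi ^ 2 with hx
  set N : ℝ := ((m + 2 : ℕ) : ℝ) with hN
  have hN1 : (1 : ℝ) ≤ N := by rw [hN]; exact_mod_cast Nat.le_add_left 1 (m + 1)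
  have hN2 : 1 ≤ N ^ 2 := one_le_pow₀ hN1
  rw [← div_eq_mul_inv, inv_eq_one_div, div_lt_div_iff₀ (by positivity) (by positivity), one_mul]
  -- `N²(1+x/2)⁴ < (2x)⁴ N² ≤ (2x N²)⁴ ≤ (1 + 2xN²)⁴`
  have h1 : (1 + x / 2) ^ 4 < (2 * x) ^ 4 :=
    pow_lt_pow_left₀ (by linarith) (by positivity) (by norm_num)
  have h2 : N ^ 2 * (2 * x) ^ 4 ≤ (2 * x * N ^ 2) ^ 4 := by
    have : N ^ 2 ≤ (N ^ 2) ^ 4 := by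
      calc N ^ 2 = (N ^ 2) ^ 1 := (pow_one _).symm
        _ ≤ (N ^ 2) ^ 4 := pow_le_pow_right₀ hN2 (by norm_num)
    nlinarith [pow_pos (show (0:ℝ) < 2 * x by positivity) 4]
  have h3 : (2 * x * N ^ 2) ^ 4 ≤ (1 + 2 * x * N ^ 2) ^ 4 :=
    pow_le_pow_left₀ (by positivity) (by linarith) 4
  calc N ^ 2 * (1 + x / 2) ^ 4 < N ^ 2 * (2 * x) ^ 4 := by gcongr
    _ ≤ (1 + 2 * x * N ^ 2) ^ 4 := h2.trans h3

/-- `0 < e_m`. [folklore] -/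
theorem leakE_pos (m : ℕ) : 0 < leakE m := by unfold leakE; have := wB_pos m; positivity

/-- `0 < p_C`. [folklore] -/
theorem leakMassC_pos (m : ℕ) : 0 < leakMassC m := by
  unfold leakMassC
  have := leakE_lt_wA m
  have := wA_lt_wC
  exact div_pos (by linarith) (by linarith)

/-- `p_C ≤ 1/5`. [folklore] -/
theorem leakMassC_le (m : ℕ) : leakMassC m ≤ 1 / 5 := by
  unfold leakMassC
  have h1 := leakE_pos m
  have h2 := three_mul_wA_le_wC
  have h3 := wA_pos
  rw [div_le_div_iff₀ (by linarith) (by norm_num)]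
  nlinarith

/-- `0 < p_A`. [folklore] -/
theorem leakMassA_pos (m : ℕ) : 0 < leakMassA m := by
  unfold leakMassA; have := leakMassC_pos m; positivity

/-- `0 < p_B`. [folklore] -/
theorem leakMassB_pos (m : ℕ) : 0 < leakMassB m := by unfold leakMassB; positivity

/-- `(8(m+2)²)⁻¹ ≤ 1/32`. [folklore] -/
theorem leakMassB_le (m : ℕ) : leakMassB m ≤ 1 / 32 := by
  unfold leakMassB
  have hN : (2 : ℝ) ≤ ((m + 2 : ℕ) : ℝ) := by exact_mod_cast Nat.le_add_left 2 m
  rw [inv_eq_one_div, div_le_div_iff₀ (by positivity) (by norm_num)]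
  nlinarith

/-- `0 ≤ p_0` (total mass of the three charged atoms is `< 1`). [folklore] -/
theorem leakMass0_nonneg (m : ℕ) : 0 ≤ leakMass0 m := by
  unfold leakMass0 leakMassA
  have h1 := leakMassC_le m
  have h2 := leakMassB_le m
  linarith

/-- All four weights are nonnegative. [folklore] -/
theorem leakWeight_nonneg (m : ℕ) : ∀ i, 0 ≤ leakWeight m i := by
  intro i
  fin_cases i
  · exact (leakMassA_pos m).le
  · exact (leakMassC_pos m).le
  · exact (leakMassB_pos m).le
  · exact leakMass0_nonneg m

/-- The four weights sum to one. [folklore] -/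
theorem sum_leakWeight (m : ℕ) : ∑ i, leakWeight m i = 1 := by
  simp only [leakWeight, Fin.sum_univ_four, Matrix.cons_val_zero, Matrix.cons_val_one, Matrix.cons_val]
  unfold leakMass0
  ring

/-- **The two-row system, solved**: `4p_A − 5p_C = 2` (energy row) and `4p_A w_A − 5p_C w_C = 2e_m` (FGT row). [folklore] -/
theorem leak_rows_system (m : ℕ) :
    4 * leakMassA m - 5 * leakMassC m = 2 ∧ 4 * leakMassA m * wA - 5 * leakMassC m * wC = 2 * leakE m := by
  have hΔ : wC - wA ≠ 0 := (sub_pos.2 wA_lt_wC).ne'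
  refine ⟨by unfold leakMassA; ring, ?_⟩
  have hC : 5 * leakMassC m * (wC - wA) = 2 * (wA - leakE m) := by
    unfold leakMassC; field_simp
  unfold leakMassA
  linear_combination (-1 : ℝ) * hC

/-- `p_B (m+2)² = 1/8`. [folklore] -/
theorem leakMassB_mul_sq (m : ℕ) : leakMassB m * ((m + 2 : ℕ) : ℝ) ^ 2 = 1 / 8 := by
  unfold leakMassB
  have : ((m + 2 : ℕ) : ℝ) ≠ 0 := by positivity
  field_simp

end Weights


section Leak

/-- `m + 2 ≠ 0` (the level of the cutoff atom). [folklore] -/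
theorem leakLevel_ne_zero (m : ℕ) : m + 2 ≠ 0 := by omega

/-- The four atoms at level `m + 2`: production `[S_{1,1/2}]`, low consumption `[S_{1,−1/4}]`, cutoff `[S_{m+2,1}]`,
null `[S_{1,0}] = 0`. -/
def leakAtom (m : ℕ) : Fin 4 → Torus.energySpace (Fin 3) :=
  ![shearState 1 one_ne_zero (1 / 2), shearState 1 one_ne_zero (-(1 / 4)), shearState (m + 2) (leakLevel_ne_zero m) 1,
    shearState 1 one_ne_zero 0]

/-- **THE LEAK LAW at level `m + 2`** (viscosity-independent as a measure; the force scales with `ν`). -/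
def leakLaw (m : ℕ) : Measure (Torus.energySpace (Fin 3)) := atomic (leakWeight m) (leakAtom m)

/-- The force of the barrier: `f_ν = 4π²ν cos(2πx₁)e₀ = S_{1,4π²ν}` (its laminar state is `S_{1,1}`). -/
def leakForce (ν : ℝ) : UnitAddTorus (Fin 3) → EuclideanSpace ℝ (Fin 3) := shearField 1 (4 * Real.pi ^ 2 * ν)

/-! ### The law: probability, level, support, budgets -/

/-- The leak law is a probability law. [folklore] -/
instance isProbabilityMeasure_leakLaw (m : ℕ) : IsProbabilityMeasure (leakLaw m) :=
  isProbabilityMeasure_atomic _ _ (leakWeight_nonneg m) (sum_leakWeight m)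

/-- Atom `0` is the production atom `[S_{1,1/2}]`. [folklore] -/
theorem leakAtom_zero (m : ℕ) : leakAtom m 0 = shearState 1 one_ne_zero (1 / 2) := rfl
/-- Atom `1` is the low consumption atom `[S_{1,−1/4}]`. [folklore] -/
theorem leakAtom_one (m : ℕ) : leakAtom m 1 = shearState 1 one_ne_zero (-(1 / 4)) := rfl
/-- Atom `2` is the cutoff atom `[S_{m+2,1}]`. [folklore] -/
theorem leakAtom_two (m : ℕ) : leakAtom m 2 = shearState (m + 2) (leakLevel_ne_zero m) 1 := rfl
/-- Atom `3` is the null atom `[S_{1,0}] = 0`. [folklore] -/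
theorem leakAtom_three (m : ℕ) : leakAtom m 3 = shearState 1 one_ne_zero 0 := rfl

/-- Every atom is a level-`(m+2)` field. [folklore] -/
theorem isLevel_leakAtom (m : ℕ) (i : Fin 4) : IsLevel (m + 2) (leakAtom m i) := by
  fin_cases i
  · exact isLevel_shearState one_ne_zero _ (by omega)
  · exact isLevel_shearState one_ne_zero _ (by omega)
  · exact isLevel_shearState (leakLevel_ne_zero m) _ le_rfl
  · exact isLevel_shearState one_ne_zero _ (by omega)

/-- Every atom lies in the unit ball. [folklore] -/
theorem norm_leakAtom_le (m : ℕ) (i : Fin 4) : ‖leakAtom m i‖ ≤ 1 := by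
  have key : ∀ (M : ℕ) (hM : M ≠ 0) (a : ℝ), a ^ 2 ≤ 2 → ‖shearState M hM a‖ ≤ 1 := fun M hM a ha => by
    have h := norm_sq_shearState hM a
    nlinarith [norm_nonneg (shearState M hM a)]
  fin_cases i
  · exact key 1 one_ne_zero _ (by norm_num)
  · exact key 1 one_ne_zero _ (by norm_num)
  · exact key (m + 2) (leakLevel_ne_zero m) _ (by norm_num)
  · exact key 1 one_ne_zero _ (by norm_num)

/-- The leak law is carried by level-`(m+2)` fields. [folklore] -/
theorem ae_isLevel_leakLaw (m : ℕ) : ∀ᵐ u ∂(leakLaw m), IsLevel (m + 2) u :=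
  ae_atomic _ _ (isLevel_leakAtom m)

/-- The leak law is supported in the unit ball. [folklore] -/
theorem ae_norm_le_leakLaw (m : ℕ) : ∀ᵐ u ∂(leakLaw m), ‖u‖ ≤ 1 :=
  ae_atomic _ _ (norm_leakAtom_le m)

/-- Mean energy of the leak law is at most `1`. [folklore] -/
theorem ensembleEnergy_leakLaw_le (m : ℕ) : Torus.ensembleEnergy (leakLaw m) ≤ 1 := by
  rw [leakLaw, ensembleEnergy_atomic _ _ (leakWeight_nonneg m)]
  calc ∑ i, leakWeight m i * ‖leakAtom m i‖ ^ 2 ≤ ∑ i, leakWeight m i * 1 := by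
        refine Finset.sum_le_sum fun i _ => mul_le_mul_of_nonneg_left ?_ (leakWeight_nonneg m i)
        have h := norm_leakAtom_le m i
        nlinarith [norm_nonneg (leakAtom m i)]
    _ = 1 := by rw [← Finset.sum_mul, sum_leakWeight, one_mul]

/-- Enstrophies of the four atoms: `π²/2`, `π²/8`, `2π²(m+2)²`, `0`. [folklore] -/
theorem eGradNormSq_leakAtom (m : ℕ) :
    Torus.eGradNormSq (((leakAtom m 0).1 : L2T3) : UnitAddTorus (Fin 3) → EuclideanSpace ℝ (Fin 3)) =
        ENNReal.ofReal (Real.pi ^ 2 / 2) ∧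
      Torus.eGradNormSq (((leakAtom m 1).1 : L2T3) : UnitAddTorus (Fin 3) → EuclideanSpace ℝ (Fin 3)) =
        ENNReal.ofReal (Real.pi ^ 2 / 8) ∧
      Torus.eGradNormSq (((leakAtom m 2).1 : L2T3) : UnitAddTorus (Fin 3) → EuclideanSpace ℝ (Fin 3)) =
        ENNReal.ofReal (2 * Real.pi ^ 2 * ((m + 2 : ℕ) : ℝ) ^ 2) ∧
      Torus.eGradNormSq (((leakAtom m 3).1 : L2T3) : UnitAddTorus (Fin 3) → EuclideanSpace ℝ (Fin 3)) = 0 := by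
  refine ⟨?_, ?_, ?_, ?_⟩
  · rw [leakAtom_zero, eGradNormSq_shearState]; congr 1; push_cast; ring
  · rw [leakAtom_one, eGradNormSq_shearState]; congr 1; push_cast; ring
  · rw [leakAtom_two, eGradNormSq_shearState]; congr 1; push_cast; ring
  · rw [leakAtom_three, eGradNormSq_shearState]; simp

/-- **Mean enstrophy of the leak law**: `p_A π²/2 + p_C π²/8 + π²/4` (the cutoff atom contributes the FIXED quantum
`π²/4` at every level). [folklore] -/
theorem ensembleEnstrophy_leakLaw (m : ℕ) :
    Torus.ensembleEnstrophy (leakLaw m) =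
      ENNReal.ofReal (leakMassA m * (Real.pi ^ 2 / 2) + leakMassC m * (Real.pi ^ 2 / 8) + Real.pi ^ 2 / 4) := by
  obtain ⟨e0, e1, e2, e3⟩ := eGradNormSq_leakAtom m
  rw [leakLaw, ensembleEnstrophy_atomic]
  simp only [Fin.sum_univ_four, e0, e1, e2, e3, mul_zero, add_zero]
  simp only [leakWeight, Matrix.cons_val_zero, Matrix.cons_val_one, Matrix.cons_val]
  have hA := (leakMassA_pos m).le
  have hC := (leakMassC_pos m).le
  have hB := (leakMassB_pos m).le
  have hpi : 0 ≤ Real.pi ^ 2 := by positivity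
  rw [← ENNReal.ofReal_mul hA, ← ENNReal.ofReal_mul hC, ← ENNReal.ofReal_mul hB,
    ← ENNReal.ofReal_add (by positivity) (by positivity), ← ENNReal.ofReal_add (by positivity) (by positivity)]
  congr 1
  have hq : leakMassB m * (2 * Real.pi ^ 2 * ((m + 2 : ℕ) : ℝ) ^ 2) = Real.pi ^ 2 / 4 := by
    unfold leakMassB
    have : ((m + 2 : ℕ) : ℝ) ≠ 0 := by positivity
    field_simp
    ring
  rw [hq]

/-- Mean enstrophy bound, `n`-uniform: `≤ π²`. [folklore] -/
theorem ensembleEnstrophy_leakLaw_le (m : ℕ) : Torus.ensembleEnstrophy (leakLaw m) ≤ ENNReal.ofReal (Real.pi ^ 2) := by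
  rw [ensembleEnstrophy_leakLaw]
  refine ENNReal.ofReal_le_ofReal ?_
  have h1 := leakMassC_le m
  have hpi : 0 < Real.pi ^ 2 := by positivity
  unfold leakMassA
  nlinarith

/-- **LOUD, uniformly in the level**: dissipation `≥ π²ν/4` (`ν ≥ 0`). [folklore] -/
theorem ensembleDissipation_leakLaw_ge (m : ℕ) {ν : ℝ} (hν : 0 ≤ ν) :
    Real.pi ^ 2 / 4 * ν ≤ Torus.ensembleDissipation ν (leakLaw m) := by
  unfold Torus.ensembleDissipation
  have hA := (leakMassA_pos m).le
  have hC := (leakMassC_pos m).le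
  have hpi : 0 ≤ Real.pi ^ 2 := by positivity
  rw [ensembleEnstrophy_leakLaw, ENNReal.toReal_ofReal (by positivity)]
  nlinarith [mul_nonneg hA hpi, mul_nonneg hC hpi]

/-! ### The two rows vanish exactly -/

/-- The barrier force is smooth. [folklore] -/
theorem isSmooth_leakForce (ν : ℝ) : Torus.IsSmooth (leakForce ν) := isSmooth_shearField 1 _
/-- The barrier force is divergence-free. [folklore] -/
theorem isDivFree_leakForce (ν : ℝ) : Torus.IsDivFree (leakForce ν) := isDivFree_shearField 1 _
/-- The barrier force has zero mean. [folklore] -/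
theorem hasZeroMean_leakForce (ν : ℝ) : Torus.HasZeroMean (leakForce ν) := hasZeroMean_shearField one_ne_zero _

/-- The energy rows of the four atoms: `π²ν/2`, `−5π²ν/8`, `−2π²ν(m+2)²`, `0`. [folklore] -/
theorem energyRow_leakAtom (ν : ℝ) (m : ℕ) :
    Torus.nsGeneratorPairing ν (leakForce ν) (leakAtom m 0) (trunc (m + 2) (leakAtom m 0)) = Real.pi ^ 2 * ν / 2 ∧
      Torus.nsGeneratorPairing ν (leakForce ν) (leakAtom m 1) (trunc (m + 2) (leakAtom m 1)) = -(5 * Real.pi ^ 2 * ν / 8) ∧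
      Torus.nsGeneratorPairing ν (leakForce ν) (leakAtom m 2) (trunc (m + 2) (leakAtom m 2)) =
        -(2 * Real.pi ^ 2 * ν * ((m + 2 : ℕ) : ℝ) ^ 2) ∧
      Torus.nsGeneratorPairing ν (leakForce ν) (leakAtom m 3) (trunc (m + 2) (leakAtom m 3)) = 0 := by
  have hm1 : m + 2 ≠ 1 := by omega
  refine ⟨?_, ?_, ?_, ?_⟩
  · rw [leakAtom_zero, leakForce, energyRow_shearState one_ne_zero _ ν _ (by omega), if_pos rfl]; push_cast; ring
  · rw [leakAtom_one, leakForce, energyRow_shearState one_ne_zero _ ν _ (by omega), if_pos rfl]; push_cast; ring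
  · rw [leakAtom_two, leakForce, energyRow_shearState _ _ ν _ le_rfl, if_neg hm1]; ring
  · rw [leakAtom_three, leakForce, energyRow_shearState one_ne_zero _ ν _ (by omega), if_pos rfl]; push_cast; ring

/-- The plain enstrophy rows of the four atoms: `4π²M²` times the energy rows. [folklore] -/
theorem enstrophyRow_leakAtom (ν : ℝ) (m : ℕ) :
    Torus.nsGeneratorPairing ν (leakForce ν) (leakAtom m 0) (lapTrunc (m + 2) (leakAtom m 0)) = 2 * Real.pi ^ 4 * ν ∧
      Torus.nsGeneratorPairing ν (leakForce ν) (leakAtom m 1) (lapTrunc (m + 2) (leakAtom m 1)) =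
        -(5 * Real.pi ^ 4 * ν / 2) ∧
      Torus.nsGeneratorPairing ν (leakForce ν) (leakAtom m 2) (lapTrunc (m + 2) (leakAtom m 2)) =
        -(8 * Real.pi ^ 4 * ν * ((m + 2 : ℕ) : ℝ) ^ 4) ∧
      Torus.nsGeneratorPairing ν (leakForce ν) (leakAtom m 3) (lapTrunc (m + 2) (leakAtom m 3)) = 0 := by
  have hm1 : m + 2 ≠ 1 := by omega
  refine ⟨?_, ?_, ?_, ?_⟩
  · rw [leakAtom_zero, leakForce, enstrophyRow_shearState one_ne_zero _ ν _ (by omega), if_pos rfl]; push_cast; ring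
  · rw [leakAtom_one, leakForce, enstrophyRow_shearState one_ne_zero _ ν _ (by omega), if_pos rfl]; push_cast; ring
  · rw [leakAtom_two, leakForce, enstrophyRow_shearState _ _ ν _ le_rfl, if_neg hm1]; ring
  · rw [leakAtom_three, leakForce, enstrophyRow_shearState one_ne_zero _ ν _ (by omega), if_pos rfl]; push_cast; ring

/-- The FGT weights of the four atoms: `w_A`, `w_C`, `w_B`, `1`. [folklore] -/
theorem fgtWeight_leakAtom (m : ℕ) :
    fgtWeight (m + 2) (leakAtom m 0) = wA ∧ fgtWeight (m + 2) (leakAtom m 1) = wC ∧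
      fgtWeight (m + 2) (leakAtom m 2) = wB m ∧ fgtWeight (m + 2) (leakAtom m 3) = 1 := by
  refine ⟨?_, ?_, ?_, ?_⟩
  · rw [leakAtom_zero, fgtWeight_shearState one_ne_zero _ (by omega), wA]; push_cast; ring
  · rw [leakAtom_one, fgtWeight_shearState one_ne_zero _ (by omega), wC]; push_cast; ring
  · rw [leakAtom_two, fgtWeight_shearState _ _ le_rfl, wB]; ring
  · rw [leakAtom_three, fgtWeight_shearState one_ne_zero _ (by omega)]; simp

/-- **THE ENERGY ROW OF THE LEAK LAW VANISHES** (production `p_A π²ν/2` = consumption `5p_C π²ν/8 + π²ν/4`). [folklore] -/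
theorem leakLaw_energyRow (ν : ℝ) (m : ℕ) :
    Integrable (fun u => Torus.nsGeneratorPairing ν (leakForce ν) u (trunc (m + 2) u)) (leakLaw m) ∧
      ∫ u, Torus.nsGeneratorPairing ν (leakForce ν) u (trunc (m + 2) u) ∂(leakLaw m) = 0 := by
  refine ⟨integrable_atomic _ _ _, ?_⟩
  obtain ⟨r0, r1, r2, r3⟩ := energyRow_leakAtom ν m
  rw [leakLaw, integral_atomic _ _ (leakWeight_nonneg m)]
  simp only [Fin.sum_univ_four, r0, r1, r2, r3, mul_zero, add_zero]
  simp only [leakWeight, Matrix.cons_val_zero, Matrix.cons_val_one, Matrix.cons_val]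
  have h := (leak_rows_system m).1
  have hq := leakMassB_mul_sq m
  linear_combination (Real.pi ^ 2 * ν / 8) * h - (2 * Real.pi ^ 2 * ν) * hq

/-- **THE FGT ROW OF THE LEAK LAW VANISHES** (`2p_A w_A = (5/2)p_C w_C + e_m`). [folklore] -/
theorem leakLaw_fgtRow (ν : ℝ) (m : ℕ) :
    Integrable (fun u => fgtWeight (m + 2) u *
        Torus.nsGeneratorPairing ν (leakForce ν) u (lapTrunc (m + 2) u)) (leakLaw m) ∧
      ∫ u, fgtWeight (m + 2) u * Torus.nsGeneratorPairing ν (leakForce ν) u (lapTrunc (m + 2) u) ∂(leakLaw m) = 0 := by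
  refine ⟨integrable_atomic _ _ _, ?_⟩
  obtain ⟨r0, r1, r2, r3⟩ := enstrophyRow_leakAtom ν m
  obtain ⟨w0, w1, w2, w3⟩ := fgtWeight_leakAtom m
  rw [leakLaw, integral_atomic _ _ (leakWeight_nonneg m)]
  simp only [Fin.sum_univ_four, r0, r1, r2, r3, w0, w1, w2, w3, mul_zero, add_zero]
  simp only [leakWeight, Matrix.cons_val_zero, Matrix.cons_val_one, Matrix.cons_val]
  have h := (leak_rows_system m).2
  have hq := leakMassB_mul_sq m
  have he : leakE m = ((m + 2 : ℕ) : ℝ) ^ 2 * wB m := rfl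
  rw [he] at h
  linear_combination (Real.pi ^ 4 * ν / 2) * h - (8 * Real.pi ^ 4 * ν * ((m + 2 : ℕ) : ℝ) ^ 2 * wB m) * hq

/-- **The leak law is FGT-STATIONARY** at level `m + 2` (the single row of S3 `stub_weightedH2` / `Negative/FGTBound.lean`),
for every `ν`. [folklore] -/
theorem isFGTStationary_leakLaw (ν : ℝ) (m : ℕ) : IsFGTStationary ν (leakForce ν) (m + 2) (leakLaw m) :=
  ⟨inferInstance, ⟨1, ae_norm_le_leakLaw m⟩, ae_isLevel_leakLaw m, leakLaw_fgtRow ν m⟩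

/-- **The PLAIN enstrophy row is violated at rate `π⁴ν((m+2)² − 1)`**: unweighted, the cutoff atom's palinstrophy deficit
`−ν‖Δū‖²` is fully visible. This is the row that would bound the mean palinstrophy (hence resolve the family) — and the one
whose stretching term has no `N`-uniform closure for genuine Galerkin ensembles. [folklore] -/
theorem leakLaw_enstrophyRow (ν : ℝ) (m : ℕ) :
    ∫ u, Torus.nsGeneratorPairing ν (leakForce ν) u (lapTrunc (m + 2) u) ∂(leakLaw m) =
      Real.pi ^ 4 * ν * (1 - ((m + 2 : ℕ) : ℝ) ^ 2) := by
  obtain ⟨r0, r1, r2, r3⟩ := enstrophyRow_leakAtom ν m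
  rw [leakLaw, integral_atomic _ _ (leakWeight_nonneg m)]
  simp only [Fin.sum_univ_four, r0, r1, r2, r3, mul_zero, add_zero]
  simp only [leakWeight, Matrix.cons_val_zero, Matrix.cons_val_one, Matrix.cons_val]
  have h := (leak_rows_system m).1
  have hq := leakMassB_mul_sq m
  linear_combination (Real.pi ^ 4 * ν / 2) * h - (8 * Real.pi ^ 4 * ν * ((m + 2 : ℕ) : ℝ) ^ 2) * hq

end Leak


section Barrier

/-! ### The leak: no uniform integrability, no resolution -/

/-- The enstrophy carried beyond any threshold `L < 2π²(m+2)²` is at least the cutoff quantum `π²/4`. [folklore] -/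
theorem lintegral_tail_leakLaw_ge (m : ℕ) {L : ℝ≥0∞} (hL : L < ENNReal.ofReal (2 * Real.pi ^ 2 * ((m + 2 : ℕ) : ℝ) ^ 2)) :
    ENNReal.ofReal (Real.pi ^ 2 / 4) ≤
      ∫⁻ u in {u : Torus.energySpace (Fin 3) |
          L < Torus.eGradNormSq ((u.1 : L2T3) : UnitAddTorus (Fin 3) → EuclideanSpace ℝ (Fin 3))},
        Torus.eGradNormSq ((u.1 : L2T3) : UnitAddTorus (Fin 3) → EuclideanSpace ℝ (Fin 3)) ∂(leakLaw m) := by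
  set s : Set (Torus.energySpace (Fin 3)) := {u | L < Torus.eGradNormSq ((u.1 : L2T3) : UnitAddTorus (Fin 3) →
    EuclideanSpace ℝ (Fin 3))} with hs
  set G : Torus.energySpace (Fin 3) → ℝ≥0∞ := fun u =>
    Torus.eGradNormSq ((u.1 : L2T3) : UnitAddTorus (Fin 3) → EuclideanSpace ℝ (Fin 3)) with hG
  have hsm : MeasurableSet s := measurableSet_lt measurable_const Torus.measurable_eGradNormSq_coe
  have e2 := (eGradNormSq_leakAtom m).2.2.1
  rw [← lintegral_indicator hsm, leakLaw, lintegral_atomic]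
  have h2 : leakAtom m 2 ∈ s := by
    change L < G (leakAtom m 2)
    rw [hG]
    dsimp only
    rw [e2]
    exact hL
  calc ENNReal.ofReal (Real.pi ^ 2 / 4) = ENNReal.ofReal (leakWeight m 2) * s.indicator G (leakAtom m 2) := by
        rw [Set.indicator_of_mem h2, hG]
        dsimp only
        rw [e2, ← ENNReal.ofReal_mul (leakWeight_nonneg m 2)]
        congr 1
        simp only [leakWeight, Matrix.cons_val]
        linear_combination (-(2 * Real.pi ^ 2)) * leakMassB_mul_sq m
    _ ≤ ∑ i, ENNReal.ofReal (leakWeight m i) * s.indicator G (leakAtom m i) :=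
        Finset.single_le_sum (f := fun i => ENNReal.ofReal (leakWeight m i) * s.indicator G (leakAtom m i))
          (fun _ _ => zero_le) (Finset.mem_univ 2)

/-- **THE LEAK FAMILY IS NOT UNIFORMLY INTEGRABLE IN ENSTROPHY** (any family containing every leak law). [folklore] -/
theorem not_uniformlyIntegrableEnstrophy_leakLaw {𝓕 : Set (Measure (Torus.energySpace (Fin 3)))}
    (h𝓕 : ∀ m : ℕ, leakLaw m ∈ 𝓕) : ¬ UniformlyIntegrableEnstrophy 𝓕 := by
  intro hUI
  have hη : (0 : ℝ≥0∞) < ENNReal.ofReal (Real.pi ^ 2 / 8) := ENNReal.ofReal_pos.2 (by positivity)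
  obtain ⟨L, hL, hUI⟩ := hUI _ hη
  -- a level beyond the threshold
  obtain ⟨m, hm⟩ := exists_nat_gt (L.toReal)
  have hLm : L < ENNReal.ofReal (2 * Real.pi ^ 2 * ((m + 2 : ℕ) : ℝ) ^ 2) := by
    rw [← ENNReal.ofReal_toReal hL]
    refine (ENNReal.ofReal_lt_ofReal_iff (by positivity)).2 ?_
    have h9 := pi_sq_gt_nine
    have hN : (m : ℝ) + 2 = ((m + 2 : ℕ) : ℝ) := by push_cast; ring
    have hm0 : (0 : ℝ) ≤ m := Nat.cast_nonneg m
    calc L.toReal < m := hm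
      _ ≤ ((m : ℝ) + 2) ^ 2 := by nlinarith
      _ ≤ 2 * Real.pi ^ 2 * ((m : ℝ) + 2) ^ 2 := by nlinarith [sq_nonneg ((m : ℝ) + 2)]
      _ = 2 * Real.pi ^ 2 * ((m + 2 : ℕ) : ℝ) ^ 2 := by rw [hN]
  have h1 := (lintegral_tail_leakLaw_ge m hLm).trans (hUI _ (h𝓕 m))
  rw [ENNReal.ofReal_le_ofReal_iff (by positivity)] at h1
  have hpi : 0 < Real.pi ^ 2 := by positivity
  linarith

/-- Truncation below the cutoff shell: the cutoff atom disappears, the low atoms do not grow. [folklore] -/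
theorem lintegral_eGradNormSq_fourierTruncate_leakLaw_le (m : ℕ) {K : ℕ} (hK : K < m + 2) :
    ∫⁻ u, Torus.eGradNormSq (Torus.fourierTruncate K ((u.1 : L2T3) : UnitAddTorus (Fin 3) → EuclideanSpace ℝ (Fin 3)))
        ∂(leakLaw m) ≤
      ENNReal.ofReal (leakMassA m * (Real.pi ^ 2 / 2) + leakMassC m * (Real.pi ^ 2 / 8)) := by
  rw [leakLaw, lintegral_atomic]
  -- atomwise bounds for the level-1 atoms
  have hlow : ∀ (a : ℝ), Torus.eGradNormSq (Torus.fourierTruncate K (((shearState 1 one_ne_zero a).1 : L2T3) :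
      UnitAddTorus (Fin 3) → EuclideanSpace ℝ (Fin 3))) ≤ ENNReal.ofReal (2 * Real.pi ^ 2 * a ^ 2) := by
    intro a
    rcases Nat.eq_zero_or_pos K with hK0 | hK0
    · subst hK0
      rw [eGradNormSq_fourierTruncate_shearState one_ne_zero zero_lt_one]
      exact zero_le
    · rw [CubicParityLoud.Negative.eGradNormSq_fourierTruncate_of_isLevel (isLevel_shearState one_ne_zero a hK0),
        eGradNormSq_shearState]
      simp
  have h0 : Torus.eGradNormSq (Torus.fourierTruncate K (((leakAtom m 0).1 : L2T3) :
      UnitAddTorus (Fin 3) → EuclideanSpace ℝ (Fin 3))) ≤ ENNReal.ofReal (Real.pi ^ 2 / 2) := by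
    rw [leakAtom_zero]; refine (hlow _).trans_eq ?_; congr 1; ring
  have h1 : Torus.eGradNormSq (Torus.fourierTruncate K (((leakAtom m 1).1 : L2T3) :
      UnitAddTorus (Fin 3) → EuclideanSpace ℝ (Fin 3))) ≤ ENNReal.ofReal (Real.pi ^ 2 / 8) := by
    rw [leakAtom_one]; refine (hlow _).trans_eq ?_; congr 1; ring
  have h2 : Torus.eGradNormSq (Torus.fourierTruncate K (((leakAtom m 2).1 : L2T3) :
      UnitAddTorus (Fin 3) → EuclideanSpace ℝ (Fin 3))) = 0 := by
    rw [leakAtom_two]; exact eGradNormSq_fourierTruncate_shearState _ hK _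
  have h3 : Torus.eGradNormSq (Torus.fourierTruncate K (((leakAtom m 3).1 : L2T3) :
      UnitAddTorus (Fin 3) → EuclideanSpace ℝ (Fin 3))) ≤ 0 := by
    rw [leakAtom_three]; refine (hlow _).trans_eq ?_; simp
  simp only [Fin.sum_univ_four, h2, mul_zero, add_zero]
  simp only [leakWeight, Matrix.cons_val_zero, Matrix.cons_val_one, Matrix.cons_val]
  have hA := (leakMassA_pos m).le
  have hC := (leakMassC_pos m).le
  calc ENNReal.ofReal (leakMassA m) * _ + ENNReal.ofReal (leakMassC m) * _ + ENNReal.ofReal (leakMass0 m) * _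
      ≤ ENNReal.ofReal (leakMassA m) * ENNReal.ofReal (Real.pi ^ 2 / 2) +
          ENNReal.ofReal (leakMassC m) * ENNReal.ofReal (Real.pi ^ 2 / 8) + ENNReal.ofReal (leakMass0 m) * 0 := by
        gcongr
    _ = ENNReal.ofReal (leakMassA m * (Real.pi ^ 2 / 2) + leakMassC m * (Real.pi ^ 2 / 8)) := by
        rw [mul_zero, add_zero, ← ENNReal.ofReal_mul hA, ← ENNReal.ofReal_mul hC,
          ← ENNReal.ofReal_add (by positivity) (by positivity)]

/-- **NO SCHEDULE RESOLVES THE LEAK FAMILY**: for every `κ`, the law at level `κ(0) + 2` violates the `n = 0` clause of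
`IsResolved κ` (the cutoff quantum `π²/4 > 1 = (0+1)⁻¹` is invisible to `P_{κ 0}`). [folklore] -/
theorem not_isResolved_leakLaw (κ : ℕ → ℕ) : ¬ IsResolved κ (leakLaw (κ 0)) := by
  intro h
  have h0 := h 0
  have hup := lintegral_eGradNormSq_fourierTruncate_leakLaw_le (κ 0) (K := κ 0) (by omega)
  have htot : ∫⁻ u, Torus.eGradNormSq ((u.1 : L2T3) : UnitAddTorus (Fin 3) → EuclideanSpace ℝ (Fin 3)) ∂(leakLaw (κ 0)) =
      ENNReal.ofReal (leakMassA (κ 0) * (Real.pi ^ 2 / 2) + leakMassC (κ 0) * (Real.pi ^ 2 / 8) + Real.pi ^ 2 / 4) :=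
    ensembleEnstrophy_leakLaw (κ 0)
  rw [htot] at h0
  have h1 := h0.trans (add_le_add hup le_rfl)
  simp only [Nat.cast_zero, zero_add, inv_one] at h1
  have hA := (leakMassA_pos (κ 0)).le
  have hC := (leakMassC_pos (κ 0)).le
  rw [← ENNReal.ofReal_one, ← ENNReal.ofReal_add (by positivity) zero_le_one,
    ENNReal.ofReal_le_ofReal_iff (by positivity)] at h1
  have h9 := pi_sq_gt_nine
  linarith

/-- … hence no `κ` resolves any family containing all the leak laws. [folklore] -/
theorem not_exists_isResolved_leakLaw {μ : ℕ → Measure (Torus.energySpace (Fin 3))} (hμ : ∀ m, μ (m + 2) = leakLaw m)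
    (κ : ℕ → ℕ) : ¬ ∀ n, 2 ≤ n → IsResolved κ (μ n) := fun h =>
  not_isResolved_leakLaw κ (by simpa [hμ] using h (κ 0 + 2) (by omega))

/-! ## 4. The barrier, stated -/

/-- **THE ROW BARRIER (data form).** For every `ν > 0` there are an admissible force and a family of laws `μ_n`
(every level `n ≥ 2`) which are probability laws carried by level-`n` fields in the unit ball, satisfy the ENERGY ROW
and the FGT ROW EXACTLY (hence carry the `N`-uniform weighted `H²` bound of S3 and a common mean-enstrophy bound `π²`),
are LOUD with `n`-uniform budgets (energy `≤ 1`, dissipation `≥ π²ν/4`) — and yet are NOT uniformly integrable in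
enstrophy and NOT resolved by any schedule `κ`. [folklore] -/
theorem rowBarrier {ν : ℝ} (hν : 0 < ν) :
    ∃ (f : UnitAddTorus (Fin 3) → EuclideanSpace ℝ (Fin 3)) (μ : ℕ → Measure (Torus.energySpace (Fin 3))),
      Torus.IsSmooth f ∧ Torus.IsDivFree f ∧ Torus.HasZeroMean f ∧
      (∀ n : ℕ, 2 ≤ n →
        IsProbabilityMeasure (μ n) ∧ (∀ᵐ u ∂(μ n), IsLevel n u) ∧ (∀ᵐ u ∂(μ n), ‖u‖ ≤ 1) ∧
        (Integrable (fun u => Torus.nsGeneratorPairing ν f u (trunc n u)) (μ n) ∧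
          ∫ u, Torus.nsGeneratorPairing ν f u (trunc n u) ∂(μ n) = 0) ∧
        IsFGTStationary ν f n (μ n) ∧
        Torus.ensembleEnergy (μ n) ≤ 1 ∧ Real.pi ^ 2 / 4 * ν ≤ Torus.ensembleDissipation ν (μ n) ∧
        Torus.ensembleEnstrophy (μ n) ≤ ENNReal.ofReal (Real.pi ^ 2)) ∧
      WeightedH2Bound 4 (Set.range fun m => μ (m + 2)) ∧
      ¬ UniformlyIntegrableEnstrophy (Set.range fun m => μ (m + 2)) ∧
      ∀ κ : ℕ → ℕ, ¬ ∀ n, 2 ≤ n → IsResolved κ (μ n) := by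
  refine ⟨leakForce ν, fun n => leakLaw (n - 2), isSmooth_leakForce ν, isDivFree_leakForce ν, hasZeroMean_leakForce ν,
    fun n hn => ?_, ?_, ?_, ?_⟩
  · obtain ⟨m, rfl⟩ : ∃ m, n = m + 2 := ⟨n - 2, by omega⟩
    simp only [Nat.add_sub_cancel]
    exact ⟨inferInstance, ae_isLevel_leakLaw m, ae_norm_le_leakLaw m, leakLaw_energyRow ν m, isFGTStationary_leakLaw ν m,
      ensembleEnergy_leakLaw_le m, ensembleDissipation_leakLaw_ge m hν.le, ensembleEnstrophy_leakLaw_le m⟩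
  · refine weightedH2Bound_four_of_fgt hν (isSmooth_leakForce ν) ?_
    rintro μ ⟨m, rfl⟩
    exact ⟨m + 2, by simpa using isFGTStationary_leakLaw ν m⟩
  · exact not_uniformlyIntegrableEnstrophy_leakLaw fun m => ⟨m, by simp⟩
  · exact not_exists_isResolved_leakLaw (fun m => by simp)

/-- The PER-FAMILY UPGRADE one might hope to prove for S4 from the rows in hand: "at fixed `ν > 0`, a family of loud level
laws in a ball satisfying the energy row and the FGT row is uniformly integrable in enstrophy". -/
def RowsForceUniformIntegrability : Prop :=
  ∀ (ν : ℝ), 0 < ν → ∀ f : UnitAddTorus (Fin 3) → EuclideanSpace ℝ (Fin 3),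
    Torus.IsSmooth f → Torus.IsDivFree f → Torus.HasZeroMean f →
    ∀ (R E ε : ℝ), 0 < ε → ∀ μ : ℕ → Measure (Torus.energySpace (Fin 3)),
    (∀ n : ℕ, 2 ≤ n → IsProbabilityMeasure (μ n) ∧ (∀ᵐ u ∂(μ n), IsLevel n u) ∧ (∀ᵐ u ∂(μ n), ‖u‖ ≤ R) ∧
      (Integrable (fun u => Torus.nsGeneratorPairing ν f u (trunc n u)) (μ n) ∧
        ∫ u, Torus.nsGeneratorPairing ν f u (trunc n u) ∂(μ n) = 0) ∧
      IsFGTStationary ν f n (μ n) ∧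
      Torus.ensembleEnergy (μ n) ≤ E ∧ ε ≤ Torus.ensembleDissipation ν (μ n)) →
    UniformlyIntegrableEnstrophy (Set.range fun m => μ (m + 2))

/-- The same upgrade with RESOLUTION (the crux's own conclusion clause) in place of uniform integrability. -/
def RowsForceResolution : Prop :=
  ∀ (ν : ℝ), 0 < ν → ∀ f : UnitAddTorus (Fin 3) → EuclideanSpace ℝ (Fin 3),
    Torus.IsSmooth f → Torus.IsDivFree f → Torus.HasZeroMean f →
    ∀ (R E ε : ℝ), 0 < ε → ∀ μ : ℕ → Measure (Torus.energySpace (Fin 3)),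
    (∀ n : ℕ, 2 ≤ n → IsProbabilityMeasure (μ n) ∧ (∀ᵐ u ∂(μ n), IsLevel n u) ∧ (∀ᵐ u ∂(μ n), ‖u‖ ≤ R) ∧
      (Integrable (fun u => Torus.nsGeneratorPairing ν f u (trunc n u)) (μ n) ∧
        ∫ u, Torus.nsGeneratorPairing ν f u (trunc n u) ∂(μ n) = 0) ∧
      IsFGTStationary ν f n (μ n) ∧
      Torus.ensembleEnergy (μ n) ≤ E ∧ ε ≤ Torus.ensembleDissipation ν (μ n)) →
    ∃ κ : ℕ → ℕ, ∀ n, 2 ≤ n → IsResolved κ (μ n)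

/-- **`¬ RowsForceUniformIntegrability`** — S4 `stub_loudUI` cannot be proved from the energy row and the FGT row (plus
loudness, ball, level): any proof must use rows on which the inertial term is visible. [folklore] -/
theorem not_rowsForceUniformIntegrability : ¬ RowsForceUniformIntegrability := fun h => by
  obtain ⟨f, μ, hfs, hfd, hfz, hfam, -, hUI, -⟩ := rowBarrier one_pos
  exact hUI (h 1 one_pos f hfs hfd hfz 1 1 (Real.pi ^ 2 / 4 * 1) (by positivity) μ fun n hn => by
    obtain ⟨h1, h2, h3, h4, h5, h6, h7, -⟩ := hfam n hn
    exact ⟨h1, h2, h3, h4, h5, h6, h7⟩)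

/-- **`¬ RowsForceResolution`** — nor can the crux's resolution clause. [folklore] -/
theorem not_rowsForceResolution : ¬ RowsForceResolution := fun h => by
  obtain ⟨f, μ, hfs, hfd, hfz, hfam, -, -, hres⟩ := rowBarrier one_pos
  obtain ⟨κ, hκ⟩ := h 1 one_pos f hfs hfd hfz 1 1 (Real.pi ^ 2 / 4 * 1) (by positivity) μ fun n hn => by
    obtain ⟨h1, h2, h3, h4, h5, h6, h7, -⟩ := hfam n hn
    exact ⟨h1, h2, h3, h4, h5, h6, h7⟩
  exact hres κ hκ

end Barrier


/-! ## MX. MIXING NEVER CREATES RESOLUTION (freedom F1) — generation 2, after strategist b1 -/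

section Mixture

/-- Band enstrophy is at most total enstrophy, in the mean (spectral, termwise). [folklore] -/
theorem lintegral_band_le (K : ℕ) (μ : Measure (Torus.energySpace (Fin 3))) :
    ∫⁻ u, Torus.eGradNormSq (Torus.fourierTruncate K ((u.1 : L2T3) : UnitAddTorus (Fin 3) → EuclideanSpace ℝ (Fin 3))) ∂μ ≤
      ∫⁻ u, Torus.eGradNormSq ((u.1 : L2T3) : UnitAddTorus (Fin 3) → EuclideanSpace ℝ (Fin 3)) ∂μ :=
  lintegral_mono fun u => Torus.eGradNormSq_fourierTruncate_le ((Lp.memLp (u.1 : L2T3)).integrable one_le_two) K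

/-- **MIXING LEMMA, explicit index.** If the mixture `a • μ₁ + b • μ₂` (`a ≠ 0` finite, `b · ∫‖∇u‖²dμ₂ < ∞`) is `κ`-resolved, then at
every index `m` with `m⁻¹ < a (n+1)⁻¹` — a condition on `a, n, m` only, NOT on the laws — the cutoff `κ m` resolves `μ₁` alone to
tolerance `(n+1)⁻¹`. (Strategist b1's `resolvable_left_of_isResolved_mixture`, with the index made explicit.) [folklore] -/
theorem resolved_left_at_of_isResolved_mixture {κ : ℕ → ℕ} {μ₁ μ₂ : Measure (Torus.energySpace (Fin 3))} {a b : ℝ≥0∞}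
    (ha : a ≠ 0) (ha' : a ≠ ⊤)
    (hfin : b * ∫⁻ u, Torus.eGradNormSq ((u.1 : L2T3) : UnitAddTorus (Fin 3) → EuclideanSpace ℝ (Fin 3)) ∂μ₂ ≠ ⊤)
    (hres : IsResolved κ (a • μ₁ + b • μ₂)) {n m : ℕ} (hm : ((m : ℝ≥0∞))⁻¹ < a * (((n : ℝ≥0∞)) + 1)⁻¹) :
    ∫⁻ u, Torus.eGradNormSq ((u.1 : L2T3) : UnitAddTorus (Fin 3) → EuclideanSpace ℝ (Fin 3)) ∂μ₁ ≤
      (∫⁻ u, Torus.eGradNormSq (Torus.fourierTruncate (κ m)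
          ((u.1 : L2T3) : UnitAddTorus (Fin 3) → EuclideanSpace ℝ (Fin 3))) ∂μ₁) + ((n : ℝ≥0∞) + 1)⁻¹ := by
  set c : ℝ≥0∞ := a * ((n : ℝ≥0∞) + 1)⁻¹ with hc
  set Z₁ : ℝ≥0∞ := ∫⁻ u, Torus.eGradNormSq ((u.1 : L2T3) : UnitAddTorus (Fin 3) → EuclideanSpace ℝ (Fin 3)) ∂μ₁ with hZ₁
  set Z₂ : ℝ≥0∞ := ∫⁻ u, Torus.eGradNormSq ((u.1 : L2T3) : UnitAddTorus (Fin 3) → EuclideanSpace ℝ (Fin 3)) ∂μ₂ with hZ₂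
  set B₁ : ℝ≥0∞ := ∫⁻ u, Torus.eGradNormSq (Torus.fourierTruncate (κ m)
    ((u.1 : L2T3) : UnitAddTorus (Fin 3) → EuclideanSpace ℝ (Fin 3))) ∂μ₁ with hB₁
  set B₂ : ℝ≥0∞ := ∫⁻ u, Torus.eGradNormSq (Torus.fourierTruncate (κ m)
    ((u.1 : L2T3) : UnitAddTorus (Fin 3) → EuclideanSpace ℝ (Fin 3))) ∂μ₂ with hB₂
  set e : ℝ≥0∞ := ((m : ℝ≥0∞) + 1)⁻¹ with he
  -- the resolution inequality of the mixture at index `m`, split over the two components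
  have hmix : a * Z₁ + b * Z₂ ≤ a * B₁ + b * B₂ + e := by
    have h := hres m
    simp only [lintegral_add_measure, lintegral_smul_measure] at h
    simpa [hZ₁, hZ₂, hB₁, hB₂, smul_eq_mul] using h
  -- the second component's band part is at most its total, and finite
  have hB₂le : b * B₂ ≤ b * Z₂ := mul_le_mul_right (lintegral_band_le (κ m) μ₂) b
  have hB₂fin : b * B₂ ≠ ⊤ := ne_top_of_le_ne_top hfin hB₂le
  -- cancel `b * B₂`
  have hstep : a * Z₁ + b * B₂ ≤ (a * B₁ + e) + b * B₂ := by
    calc a * Z₁ + b * B₂ ≤ a * Z₁ + b * Z₂ := add_le_add le_rfl hB₂le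
      _ ≤ a * B₁ + b * B₂ + e := hmix
      _ = (a * B₁ + e) + b * B₂ := by ring
  have haZ : a * Z₁ ≤ a * B₁ + e := ENNReal.le_of_add_le_add_right hB₂fin hstep
  -- divide by `a`
  have hdiv : Z₁ ≤ B₁ + a⁻¹ * e := by
    have h1 : a⁻¹ * (a * Z₁) ≤ a⁻¹ * (a * B₁ + e) := mul_le_mul_right haZ _
    have hinv : a⁻¹ * a = 1 := ENNReal.inv_mul_cancel ha ha'
    calc Z₁ = a⁻¹ * (a * Z₁) := by rw [← mul_assoc, hinv, one_mul]
      _ ≤ a⁻¹ * (a * B₁ + e) := h1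
      _ = B₁ + a⁻¹ * e := by rw [mul_add, ← mul_assoc, hinv, one_mul]
  -- the index makes `a⁻¹ * e ≤ (n+1)⁻¹`
  have hem : e ≤ c := by
    have h1 : e ≤ (m : ℝ≥0∞)⁻¹ := ENNReal.inv_le_inv.2 (by simp)
    exact h1.trans hm.le
  have htol : a⁻¹ * e ≤ ((n : ℝ≥0∞) + 1)⁻¹ := by
    calc a⁻¹ * e ≤ a⁻¹ * c := mul_le_mul_right hem _
      _ = ((n : ℝ≥0∞) + 1)⁻¹ := by rw [hc, ← mul_assoc, ENNReal.inv_mul_cancel ha ha', one_mul]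
  exact hdiv.trans (add_le_add le_rfl htol)

/-- A law-INDEPENDENT admissible index: some `m` with `m⁻¹ < a (n+1)⁻¹` (`a ≠ 0`). [folklore] -/
theorem exists_mixIdx {a : ℝ≥0∞} (ha : a ≠ 0) (n : ℕ) : ∃ m : ℕ, ((m : ℝ≥0∞))⁻¹ < a * (((n : ℝ≥0∞)) + 1)⁻¹ :=
  ENNReal.exists_inv_nat_lt (mul_ne_zero ha (ENNReal.inv_ne_zero.2 (by simp)))

/-- **MIXING NEVER CREATES RESOLUTION (freedom F1 void).** If `a • μ₁ + b • μ₂` is `κ`-resolved (`a ≠ 0` finite, `b·∫‖∇u‖²dμ₂ < ∞`),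
then `μ₁` is resolved by a reparametrisation `κ ∘ m` of the same schedule, where `m : ℕ → ℕ` depends on `a` ONLY (not on the laws).
Strategist b1's `exists_isResolved_left_of_mixture`, uniformised. [folklore] -/
theorem exists_isResolved_left_of_mixture {a : ℝ≥0∞} (ha : a ≠ 0) (ha' : a ≠ ⊤) :
    ∃ m : ℕ → ℕ, ∀ (κ : ℕ → ℕ) (μ₁ μ₂ : Measure (Torus.energySpace (Fin 3))) (b : ℝ≥0∞),
      b * ∫⁻ u, Torus.eGradNormSq ((u.1 : L2T3) : UnitAddTorus (Fin 3) → EuclideanSpace ℝ (Fin 3)) ∂μ₂ ≠ ⊤ →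
      IsResolved κ (a • μ₁ + b • μ₂) → IsResolved (fun n => κ (m n)) μ₁ := by
  choose m hm using exists_mixIdx ha
  exact ⟨m, fun κ μ₁ μ₂ b hfin hres n => resolved_left_at_of_isResolved_mixture ha ha' hfin hres (hm n)⟩

/-- **ADMIXTURE CANNOT REPAIR THE LEAK FAMILY** (row barrier + mixing lemma): for every schedule `κ`, every fixed weight `a ≠ 0`
(finite) and any admixed laws `μ₂ m` with `b · ∫‖∇u‖²dμ₂ m < ∞`, the mixtures `a • leakLaw m + b • μ₂ m` are NOT all `κ`-resolved —
otherwise ONE law-independent reparametrisation of `κ` would resolve every `leakLaw m`, contradicting `not_isResolved_leakLaw`. [folklore] -/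
theorem not_isResolved_mixture_leakLaw (κ : ℕ → ℕ) {a b : ℝ≥0∞} (ha : a ≠ 0) (ha' : a ≠ ⊤)
    (μ₂ : ℕ → Measure (Torus.energySpace (Fin 3)))
    (hfin : ∀ m, b * ∫⁻ u, Torus.eGradNormSq ((u.1 : L2T3) : UnitAddTorus (Fin 3) → EuclideanSpace ℝ (Fin 3)) ∂μ₂ m ≠ ⊤) :
    ¬ ∀ m : ℕ, IsResolved κ (a • leakLaw m + b • μ₂ m) := by
  intro h
  obtain ⟨r, hr⟩ := exists_isResolved_left_of_mixture ha ha'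
  have hall : ∀ m, IsResolved (fun n => κ (r n)) (leakLaw m) := fun m => hr κ (leakLaw m) (μ₂ m) b (hfin m) (h m)
  exact not_isResolved_leakLaw (fun n => κ (r n)) (hall _)

end Mixture


end

end Summit.AnomalousDissipation.AnomalousDissipation.Cruxes.UniformResolution.Disproof
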